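import Literature.NumberTheory.ConnesConsani2021.SoninTraceReduction
import Literature.NumberTheory.ConnesConsani2021.ProlateProjectionsProofs
import Literature.NumberTheory.ConnesConsani2021.ProlateProjectionsCompleteness
import Literature.Analysis.OperatorTheory.IntegralOperatorHilbertSchmidt
import HarnessLib

/-!
# Connes–Consani 2021 §4: the trace bookkeeping over the prolate orthonormal basis, CONDITIONAL on
# its completeness — eq. (spectral), Remark 4.6 (i), Lemma 4.1 / Prop. 4.5 (ii) from `CC2021_sec4_xi_complete`

RH-FREE corpus literature (archimedean place only: Parseval/Bessel bookkeeping over the even prolate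
spheroidal basis of `𝒫₁L²(ℝ)_ev`; no zeta zeros, no Weil positivity, nothing here bears on the truth of
RH).  Cell `rh-crit`, sub-cell `cc`, row O12 (cc-lead R39); bears_on W-C/W-P only as the §4 inputs
`hii` / `h46i` / `hsp` of seat t4's `CC2021_thm_4_7_weak_of_traces` (apex input (A), route item K1).
WHAT THIS IS NOT: a statement about RH.

A. Connes, C. Consani, *Weil positivity and trace formula, the archimedean place*, Selecta Math.
(N.S.) 27 (2021) 77 = arXiv:2006.13771 [bib: `ConnesConsani2021`], §4 pp. 15–18 (arXiv items 21–26).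
The statement layer is seat t3's `ProlateProjections.lean` (every symbol below is t3's; nothing is
restated) and its discharge file `ProlateProjectionsProofs.lean` (`CC2021_sec4_xi_orthonormal_holds`,
`CC2021_prop_4_5_i_holds`, `prolatePsi_eq`, `norm_prolatePsi`, `inner_prolatePsi_eq_zero`, …); the
`L²(ℝ)_ev` / Sonin-projection bookkeeping is seat O4a's `SoninTraceReduction.lean`.  Theorems only:
no definition, no named fact, no instance.

## What is proved (all from the ONE named fact `CC2021_sec4_xi_complete`, "the vectors `ξ_n` form an
## orthonormal basis of the range of `𝒫₁`" in `L²(ℝ)_ev`, proof of Prop. 4.5 p. 17)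

* `hasSum_inner_smul_prolateXi_of_xi_complete` — `𝒫₁ x = Σ_n ⟨ξ_n|x⟩ ξ_n` for even `x`, and its Fourier
  transport `hasSum_inner_smul_prolateEta_of_xi_complete` — `𝒫̂₁ x = Σ_n ⟨η_n|x⟩ η_n` ((chirem2):
  "`𝒫̂₁𝒫₁ = Σ λ(n)|η_n⟩⟨ξ_n|`").
* **`CC2021_rem_4_6_i_of_xi_complete`** — Remark 4.6 (i) `Σ_n λ(n)² = δ(1)` (`Tr(𝒫̂₁𝒫₁) = δ(1)`,
  Lemma 4.1 at `ρ = 1`), as the Hilbert–Schmidt norm of the kernel `2cos(2πxy)` on `L²((0,1])` in the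
  Hilbert basis `√2 ξ_n|_{(0,1]}` (completeness transported from `CC2021_sec4_xi_complete`).
* **`CC2021_lem_4_1_of_xi_complete`**, **`CC2021_prop_4_5_ii_of_xi_complete`** — Lemma 4.1
  `Tr(ϑ(ρ⁻¹)𝒫̂₁𝒫₁) = δ(ρ)` and Prop. 4.5 (ii) eq. (chirem3) for `ρ ≥ 1`, both from
  `hasSum_prolateEigen_mul_repCoeff_of_xi_complete` (`Σ_n λ(n)⟨ξ_n|ϑ(ρ⁻¹)η_n⟩ = δ(ρ)`: the
  Hilbert–Schmidt pairing of the kernels `2cos(2πxy)` and `2ρ^{1/2}cos(2πρxy)` on `L²((0,1])`, by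
  polarisation of the tree's HS identity, `= 4ρ^{1/2}∫_Δ = δ(ρ)`), with `prolateEtaFun_eq_integral_cos`
  (`η_n(u) = ∫_{−1}^{1} h_n(y)cos(2πyu)dy` for all real `u`).
* `CC2021_rem_4_6_i_of_prop_4_5_ii` (seat gm-t14's bridge, pasted with credit): Remark 4.6 (i) from
  Prop. 4.5 (ii) at `ρ = 1`, no completeness needed.
* **`CC2021_prop_4_5_spectral_of_xi_complete`** — eq. (spectral) `P P̂ P = Σ λ(n)²|ζ_n⟩⟨ζ_n| + 𝐒` on
  `L²(ℝ)_ev` (proof of Prop. 4.5 (iii) p. 17; "Sonin's space is the eigenspace of `PP̂P` for the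
  eigenvalue `1`, so that `R = 𝐒`", p. 18): `P𝒫̂₁P = Σ|ψ_n⟩⟨ψ_n|` from the `η_n`-expansion, and
  `(ζ_n)` is an orthonormal basis of `PL²(ℝ)_ev ⊖ S(1,1)` (a vector of `PL²_ev` orthogonal to every
  `ψ_n = Pη_n` is orthogonal to every `η_n`, hence killed by `𝒫̂₁`, hence in `S(1,1)`).

[RH-FREE; nothing here bears on the truth of RH.]
-/

noncomputable section

open _root_.MeasureTheory Complex Set Filter FourierTransform Topology
open scoped Real ComplexConjugate ENNReal InnerProductSpace SchwartzMap

namespace Literature.NumberTheory.ConnesConsani2021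

open Literature.NumberTheory.LFunctions Literature.Analysis.OperatorTheory Submodule

/-! ## A generic Hilbert-space lemma: expansion along an orthonormal family -/

section Generic

variable {𝕜 : Type*} [RCLike 𝕜] {E : Type*} [NormedAddCommGroup E] [InnerProductSpace 𝕜 E]
  [CompleteSpace E]

/-- **Expansion along an orthonormal family**: for an orthonormal family `v` and any vector `x`,
`Σ_i ⟨v_i|x⟩ v_i` converges to the orthogonal projection of `x` onto the closed span of the family
(Reed–Simon's Theorem II.6 eq. (II.1) `y = Σ_α (x_α, y) x_α` in the Hilbert space `M̄ = span̄{v_i}`,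
`y = P_{M̄} x`, `(v_i, P_{M̄}x) = (v_i, x)`).
[cite: ReedSimonI1980, §II.3 Thm. II.6 eq. (II.1) (galaxy panama:340977453629510 p0041:L27), applied in the closed span with §II.2 Thm. II.3] -/
theorem hasSum_inner_smul_starProjection_of_orthonormal {ι : Type*} {v : ι → E}
    (hv : Orthonormal 𝕜 v) (x : E) :
    HasSum (fun i ↦ ⟪v i, x⟫_𝕜 • v i)
      ((span 𝕜 (Set.range v)).topologicalClosure.starProjection x) := by
  set K : Submodule 𝕜 E := (span 𝕜 (Set.range v)).topologicalClosure with hK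
  have hmem : ∀ i, v i ∈ K := fun i ↦
    (span 𝕜 (Set.range v)).le_topologicalClosure (subset_span ⟨i, rfl⟩)
  set w : ι → K := fun i ↦ ⟨v i, hmem i⟩ with hw
  have hvw : (K.subtypeₗᵢ ∘ w) = v := funext fun i ↦ rfl
  have hwo : Orthonormal 𝕜 w := by
    rw [← K.subtypeₗᵢ.orthonormal_comp_iff, hvw]
    exact hv
  -- the span of `w` has trivial orthogonal complement inside `K`
  have hbot : (span 𝕜 (Set.range w))ᗮ = ⊥ := by
    rw [Submodule.eq_bot_iff]
    intro u hu
    have h1 : (u : E) ∈ (span 𝕜 (Set.range v))ᗮ := by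
      rw [Submodule.mem_orthogonal]
      intro y hy
      have himg : span 𝕜 (Set.range v) = (span 𝕜 (Set.range w)).map K.subtype := by
        rw [← Submodule.span_image]
        congr 1
        ext z
        constructor
        · rintro ⟨i, rfl⟩
          exact ⟨w i, ⟨i, rfl⟩, rfl⟩
        · rintro ⟨z', ⟨i, rfl⟩, rfl⟩
          exact ⟨i, rfl⟩
      rw [himg, Submodule.mem_map] at hy
      obtain ⟨y', hy', rfl⟩ := hy
      have := (Submodule.mem_orthogonal _ _).1 hu y' hy'
      rwa [Submodule.coe_inner] at this
    have h2 : (u : E) ∈ Kᗮ := by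
      have hKo : Kᗮ = (span 𝕜 (Set.range v))ᗮ := Submodule.orthogonal_closure _
      rw [hKo]
      exact h1
    have h3 : ⟪(u : E), (u : E)⟫_𝕜 = 0 := Submodule.inner_right_of_mem_orthogonal u.2 h2
    exact_mod_cast inner_self_eq_zero.1 h3
  set b : HilbertBasis ι 𝕜 K := HilbertBasis.mkOfOrthogonalEqBot hwo hbot with hb
  have hbw : ∀ i, b i = w i := fun i ↦ by
    rw [hb, HilbertBasis.coe_mkOfOrthogonalEqBot]
  have hsum := b.hasSum_repr (K.orthogonalProjectionOnto x)
  have hsum' := hsum.mapL K.subtypeL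
  have e1 : K.subtypeL (K.orthogonalProjectionOnto x) = K.starProjection x := rfl
  rw [e1] at hsum'
  have hcoef : ∀ i, b.repr (K.orthogonalProjectionOnto x) i = ⟪v i, x⟫_𝕜 := fun i ↦ by
    rw [HilbertBasis.repr_apply_apply, hbw, Submodule.coe_inner,
      Submodule.coe_orthogonalProjectionOnto_apply, ← Submodule.inner_starProjection_left_eq_right,
      Submodule.starProjection_eq_self_iff.2 (hmem i)]
  have hfun : (fun i ↦ K.subtypeL (b.repr (K.orthogonalProjectionOnto x) i • b i))
      = fun i ↦ ⟪v i, x⟫_𝕜 • v i := by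
    funext i
    rw [ContinuousLinearMap.map_smul, hcoef i, hbw]
    rfl
  rw [hfun] at hsum'
  exact hsum'

end Generic

/-! ## The expansions `𝒫₁ = Σ|ξ_n⟩⟨ξ_n|`, `𝒫̂₁ = Σ|η_n⟩⟨η_n|`, `P𝒫̂₁P = Σ|ψ_n⟩⟨ψ_n|`, `P − 𝐒 = Σ|ζ_n⟩⟨ζ_n|` on `L²(ℝ)_ev` -/

section Expansions

/-- `⟪T u, v⟫ = ⟪u, T v⟫` for a self-adjoint bounded operator. [folklore] -/
private theorem inner_map_comm {T : Lp ℂ 2 (volume : Measure ℝ) →L[ℂ] Lp ℂ 2 (volume : Measure ℝ)}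
    (hT : IsSelfAdjoint T) (u v : Lp ℂ 2 (volume : Measure ℝ)) : ⟪T u, v⟫_ℂ = ⟪u, T v⟫_ℂ := by
  rw [← ContinuousLinearMap.adjoint_inner_right T u v, hT.adjoint_eq]

/-- `P = 1 − 𝒫₁` is an orthogonal projection. [cite: ConnesConsani2021, §4 p. 15 eq. (complementproj) (chunk p0015:L42–L48)] -/
private theorem isStarProjection_outerProj' : IsStarProjection outerProj :=
  (isStarProjection_cutoffProj 1).one_sub

/-- `𝒫₁ P = 0`. [cite: ConnesConsani2021, §4 p. 15 eq. (complementproj) (chunk p0015:L42–L48)] -/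
private theorem cutoffProj_outerProj (x : Lp ℂ 2 (volume : Measure ℝ)) : cutoffProj 1 (outerProj x) = 0 := by
  rw [outerProj_apply, map_sub, sub_eq_zero]
  exact (congrArg (fun T : Lp ℂ 2 (volume : Measure ℝ) →L[ℂ] Lp ℂ 2 (volume : Measure ℝ) ↦ T x)
    (cutoffProj_idem 1).eq).symm

/-- `P P = P`. [cite: ConnesConsani2021, §4 p. 15 eq. (complementproj) (chunk p0015:L42–L48)] -/
private theorem outerProj_outerProj (x : Lp ℂ 2 (volume : Measure ℝ)) :
    outerProj (outerProj x) = outerProj x := by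
  conv_lhs => rw [outerProj_apply, cutoffProj_outerProj, sub_zero]

/-- `P u = u` when `𝒫₁ u = 0`. [cite: ConnesConsani2021, §4 p. 15 eq. (complementproj) (chunk p0015:L42–L48)] -/
private theorem outerProj_eq_self_of_cutoffProj_eq_zero {u : Lp ℂ 2 (volume : Measure ℝ)}
    (hu : cutoffProj 1 u = 0) : outerProj u = u := by
  rw [outerProj_apply, hu, sub_zero]

/-- **`𝒫₁ = Σ_n |ξ_n⟩⟨ξ_n|` on `L²(ℝ)_ev`** ("the vectors `ξ_n` form an orthonormal basis of the range
of `𝒫₁`", proof of Prop. 4.5 (ii), p. 17), from the completeness fact `CC2021_sec4_xi_complete`: for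
even `x`, `Σ_n ⟨ξ_n|x⟩ ξ_n = 𝒫₁ x`. [cite: ConnesConsani2021, Prop. 4.5 (ii) proof §4 p. 17 (chunk p0017:L2–L4)] -/
theorem hasSum_inner_smul_prolateXi_of_xi_complete (h : CC2021_sec4_xi_complete)
    {x : Lp ℂ 2 (volume : Measure ℝ)} (hx : x ∈ evenPart) :
    HasSum (fun n : ℕ ↦ ⟪prolateXi n, x⟫_ℂ • prolateXi n) (cutoffProj 1 x) := by
  have hon : Orthonormal ℂ prolateXi := CC2021_sec4_xi_orthonormal_holds
  set K : Submodule ℂ (Lp ℂ 2 (volume : Measure ℝ)) :=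
    (span ℂ (Set.range prolateXi)).topologicalClosure with hK
  have hsum := hasSum_inner_smul_starProjection_of_orthonormal hon x
  -- `K ⊆ L²(ℝ)_ev` and `𝒫₁ = 1` on `K`
  have hKev : K ≤ evenPart := by
    refine Submodule.topologicalClosure_minimal _ (Submodule.span_le.2 ?_) isClosed_evenPart
    rintro _ ⟨n, rfl⟩
    exact prolateXi_mem_evenPart n
  have hKfix : ∀ u ∈ K, cutoffProj 1 u = u := by
    intro u hu
    have hle : K ≤ LinearMap.ker ((cutoffProj 1 - 1 : Lp ℂ 2 (volume : Measure ℝ) →L[ℂ]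
        Lp ℂ 2 (volume : Measure ℝ)) : Lp ℂ 2 (volume : Measure ℝ) →ₗ[ℂ] Lp ℂ 2 (volume : Measure ℝ)) := by
      refine Submodule.topologicalClosure_minimal _ (Submodule.span_le.2 ?_)
        (ContinuousLinearMap.isClosed_ker _)
      rintro _ ⟨n, rfl⟩
      rw [SetLike.mem_coe, LinearMap.mem_ker, ContinuousLinearMap.coe_coe,
        show (cutoffProj 1 - 1) (prolateXi n) = cutoffProj 1 (prolateXi n) - prolateXi n from rfl,
        cutoffProj_prolateXi, sub_self]
    have h1 := hle hu
    rw [LinearMap.mem_ker, ContinuousLinearMap.coe_coe,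
      show (cutoffProj 1 - 1) u = cutoffProj 1 u - u from rfl, sub_eq_zero] at h1
    exact h1
  have hPx : K.starProjection x ∈ K := Submodule.starProjection_apply_mem K x
  -- `z = 𝒫₁x − 𝐏_K x` is even, fixed by `𝒫₁` and orthogonal to every `ξ_n`, hence `0`
  have hz : cutoffProj 1 x - K.starProjection x = 0 := by
    refine h _ (evenPart.sub_mem (cutoffProj_mem_evenPart 1 hx) (hKev hPx)) ?_ fun n ↦ ?_
    · rw [map_sub, hKfix _ hPx]
      congr 1
      exact congrArg (fun T : Lp ℂ 2 (volume : Measure ℝ) →L[ℂ] Lp ℂ 2 (volume : Measure ℝ) ↦ T x)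
        (cutoffProj_idem 1).eq
    · rw [inner_sub_right, ← inner_map_comm (cutoffProj_isSelfAdjoint 1), cutoffProj_prolateXi,
        ← Submodule.inner_starProjection_left_eq_right,
        Submodule.starProjection_eq_self_iff.2
          ((span ℂ (Set.range prolateXi)).le_topologicalClosure (subset_span ⟨n, rfl⟩)), sub_self]
  rw [sub_eq_zero.1 hz]
  exact hsum

/-- **(chirem2) `𝒫̂₁ = Σ_n |η_n⟩⟨η_n|` on `L²(ℝ)_ev`**: for even `x`, `Σ_n ⟨η_n|x⟩ η_n = 𝒫̂₁ x`
(conjugate the `ξ_n`-expansion of `𝒫₁` by the unitary `𝔽_{e_ℝ}`: `η_n = 𝔽ξ_n = 𝔽⁻¹ξ_n`).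
[cite: ConnesConsani2021, Prop. 4.5 (ii) proof §4 p. 17 eq. (chirem1.5)–(chirem2) (chunk p0017:L5–L10)] -/
theorem hasSum_inner_smul_prolateEta_of_xi_complete (h : CC2021_sec4_xi_complete)
    {x : Lp ℂ 2 (volume : Measure ℝ)} (hx : x ∈ evenPart) :
    HasSum (fun n : ℕ ↦ ⟪prolateEta n, x⟫_ℂ • prolateEta n) (cutoffProjHat 1 x) := by
  have hy : (𝓕 x : Lp ℂ 2 (volume : Measure ℝ)) ∈ evenPart := fourier_mem_evenPart hx
  have h1 := (hasSum_inner_smul_prolateXi_of_xi_complete h hy).mapL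
    ((Lp.fourierTransformₗᵢ ℝ ℂ).symm.toContinuousLinearEquiv :
      Lp ℂ 2 (volume : Measure ℝ) →L[ℂ] Lp ℂ 2 (volume : Measure ℝ))
  have hcoef : ∀ n : ℕ, ⟪prolateXi n, (𝓕 x : Lp ℂ 2 (volume : Measure ℝ))⟫_ℂ = ⟪prolateEta n, x⟫_ℂ := by
    intro n
    rw [← fourierInv_prolateXi n, ← Lp.inner_fourier_eq (𝓕⁻ (prolateXi n) : Lp ℂ 2 (volume : Measure ℝ)) x,
      fourier_fourierInv_eq]
  convert h1 using 1
  · funext n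
    rw [map_smul, hcoef n]
    congr 1
    exact (fourierInv_prolateXi n).symm
  · rfl

/-- **`P 𝒫̂₁ P = Σ_n |ψ_n⟩⟨ψ_n|` on `L²(ℝ)_ev`** (`ψ_n = P η_n`): for even `x`,
`Σ_n ⟨ψ_n|x⟩ ψ_n = P 𝒫̂₁ P x`. [cite: ConnesConsani2021, Prop. 4.5 (iii) proof §4 p. 17 (chunk p0017:L20–L35)] -/
theorem hasSum_inner_smul_prolatePsi_of_xi_complete (h : CC2021_sec4_xi_complete)
    {x : Lp ℂ 2 (volume : Measure ℝ)} (hx : x ∈ evenPart) :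
    HasSum (fun n : ℕ ↦ ⟪prolatePsi n, x⟫_ℂ • prolatePsi n)
      (outerProj (cutoffProjHat 1 (outerProj x))) := by
  have h1 := (hasSum_inner_smul_prolateEta_of_xi_complete h (outerProj_mem_evenPart hx)).mapL outerProj
  convert h1 using 1
  funext n
  rw [map_smul, prolatePsi, inner_map_comm isStarProjection_outerProj'.isSelfAdjoint]

/-- `P P̂ P x = P x − P 𝒫̂₁ P x`. [cite: ConnesConsani2021, Prop. 4.5 (iii) proof §4 p. 17 (chunk p0017:L59–L63)] -/
theorem outerProj_outerProjHat_outerProj_eq_sub (x : Lp ℂ 2 (volume : Measure ℝ)) :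
    outerProj (outerProjHat (outerProj x)) = outerProj x - outerProj (cutoffProjHat 1 (outerProj x)) := by
  rw [outerProjHat_apply, map_sub, outerProj_outerProj]

/-- **`ψ_n ⊥ S(1,1)`**: `𝐒 ψ_n = 0` (for `s ∈ S(1,1)`: `⟨s|Pη_n⟩ = ⟨s|η_n⟩ = ⟨s|𝒫̂₁η_n⟩ = ⟨𝒫̂₁s|η_n⟩ = 0`).
[cite: ConnesConsani2021, Prop. 4.5 (iii) proof §4 p. 17 eq. (spectral) (chunk p0017:L59–L63)] -/
theorem soninProjection_prolatePsi (n : ℕ) : soninProjection 1 1 (prolatePsi n) = 0 := by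
  unfold soninProjection
  rw [Submodule.starProjection_apply_eq_zero_iff, Submodule.mem_orthogonal]
  intro s hs
  obtain ⟨-, hs1, hs2⟩ := mem_soninSpace_iff_cutoffProj.1 hs
  rw [prolatePsi, ← inner_map_comm isStarProjection_outerProj'.isSelfAdjoint,
    outerProj_eq_self_of_cutoffProj_eq_zero hs1, ← cutoffProjHat_prolateEta,
    ← inner_map_comm (isStarProjection_cutoffProjHat 1).isSelfAdjoint, hs2, inner_zero_left]

/-- `𝐒 ζ_n = 0`. [cite: ConnesConsani2021, Prop. 4.5 (iii) proof §4 p. 17 eq. (spectral) (chunk p0017:L59–L63)] -/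
theorem soninProjection_prolateZeta (n : ℕ) : soninProjection 1 1 (prolateZeta n) = 0 := by
  rw [prolateZeta, map_smul, soninProjection_prolatePsi, smul_zero]

/-- `𝒫₁ ψ_n = 0`. [cite: ConnesConsani2021, Prop. 4.5 (i) §4 p. 16 (chunk p0016:L50)] -/
theorem cutoffProj_prolatePsi (n : ℕ) : cutoffProj 1 (prolatePsi n) = 0 := by
  rw [prolatePsi, cutoffProj_outerProj]

/-- `𝒫₁ ζ_n = 0`. [cite: ConnesConsani2021, Prop. 4.5 (iii) §4 p. 16 (chunk p0016:L56–L59)] -/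
theorem cutoffProj_prolateZeta (n : ℕ) : cutoffProj 1 (prolateZeta n) = 0 := by
  rw [prolateZeta, map_smul, cutoffProj_prolatePsi, smul_zero]

/-- **The `ζ_n` are orthonormal** (`‖ψ_n‖ = √(1 − λ(n)²) > 0`, `ψ_n ⊥ ψ_m`; t3's `norm_prolatePsi`,
`inner_prolatePsi_eq_zero`, `abs_prolateEigen_lt_one`). [cite: ConnesConsani2021, Prop. 4.5 (iii) §4 p. 16 (chunk p0016:L56–L59)] -/
theorem orthonormal_prolateZeta_of_proofs : Orthonormal ℂ prolateZeta := by
  have hpos : ∀ n : ℕ, 0 < Real.sqrt (1 - prolateEigen n ^ 2) := fun n ↦ by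
    have h := abs_prolateEigen_lt_one n
    exact Real.sqrt_pos.2 (by nlinarith [abs_nonneg (prolateEigen n), sq_abs (prolateEigen n)])
  rw [orthonormal_iff_ite]
  intro n m
  rw [prolateZeta, prolateZeta, inner_smul_left, inner_smul_right, Complex.conj_ofReal]
  split_ifs with hnm
  · subst hnm
    rw [inner_self_eq_norm_sq_to_K, norm_prolatePsi]
    have hc : ((Real.sqrt (1 - prolateEigen n ^ 2) : ℝ) : ℂ) ≠ 0 := by exact_mod_cast (hpos n).ne'
    have hinv := inv_mul_cancel₀ hc
    push_cast
    linear_combination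
      ((((Real.sqrt (1 - prolateEigen n ^ 2) : ℝ) : ℂ))⁻¹ * ((Real.sqrt (1 - prolateEigen n ^ 2) : ℝ) : ℂ)
        + 1) * hinv
  · rw [inner_prolatePsi_eq_zero hnm, mul_zero, mul_zero]

/-- **`P − 𝐒 = Σ_n |ζ_n⟩⟨ζ_n|` on `L²(ℝ)_ev`**: the `ζ_n` form an orthonormal basis of
`PL²(ℝ)_ev ⊖ S(1,1)` — for even `x`, `Σ_n ⟨ζ_n|x⟩ ζ_n = Px − 𝐒x`.  Completeness: an even vector fixed by
`P`, orthogonal to all `ψ_n = Pη_n` and to `S(1,1)`, is orthogonal to all `η_n`, hence killed by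
`𝒫̂₁ = Σ|η_n⟩⟨η_n|`, hence lies in `S(1,1)`, hence vanishes ("Sonin's space is the eigenspace of `PP̂P`
for the eigenvalue `1`, so that `R = 𝐒`", p. 18).
[cite: ConnesConsani2021, Prop. 4.5 (iii) proof §4 p. 17 eq. (spectral) (chunk p0017:L59–L63); Thm. 4.7 proof p. 18 (chunk p0018:L80–L83)] -/
theorem hasSum_inner_smul_prolateZeta_of_xi_complete (h : CC2021_sec4_xi_complete)
    {x : Lp ℂ 2 (volume : Measure ℝ)} (hx : x ∈ evenPart) :
    HasSum (fun n : ℕ ↦ ⟪prolateZeta n, x⟫_ℂ • prolateZeta n)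
      (outerProj x - soninProjection 1 1 x) := by
  have hon := orthonormal_prolateZeta_of_proofs
  set K : Submodule ℂ (Lp ℂ 2 (volume : Measure ℝ)) :=
    (span ℂ (Set.range prolateZeta)).topologicalClosure with hK
  have hsum := hasSum_inner_smul_starProjection_of_orthonormal hon x
  have hmemK : ∀ n : ℕ, prolateZeta n ∈ K := fun n ↦
    (span ℂ (Set.range prolateZeta)).le_topologicalClosure (subset_span ⟨n, rfl⟩)
  -- three closed properties of `K`: even, killed by `𝒫₁`, orthogonal to `S(1,1)`
  have hKev : K ≤ evenPart := by
    refine Submodule.topologicalClosure_minimal _ (Submodule.span_le.2 ?_) isClosed_evenPart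
    rintro _ ⟨n, rfl⟩
    exact prolateZeta_mem_evenPart n
  have hKker : ∀ u ∈ K, cutoffProj 1 u = 0 := by
    have hle : K ≤ LinearMap.ker ((cutoffProj 1 : Lp ℂ 2 (volume : Measure ℝ) →L[ℂ]
        Lp ℂ 2 (volume : Measure ℝ)) : Lp ℂ 2 (volume : Measure ℝ) →ₗ[ℂ] Lp ℂ 2 (volume : Measure ℝ)) := by
      refine Submodule.topologicalClosure_minimal _ (Submodule.span_le.2 ?_)
        (ContinuousLinearMap.isClosed_ker _)
      rintro _ ⟨n, rfl⟩
      exact cutoffProj_prolateZeta n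
    exact fun u hu ↦ hle hu
  have hKorth : K ≤ (soninSpace 1 1)ᗮ := by
    refine Submodule.topologicalClosure_minimal _ (Submodule.span_le.2 ?_)
      (Submodule.isClosed_orthogonal _)
    rintro _ ⟨n, rfl⟩
    have h0 := soninProjection_prolateZeta n
    unfold soninProjection at h0
    exact (Submodule.starProjection_apply_eq_zero_iff _).1 h0
  have hSK : ∀ u ∈ K, soninProjection 1 1 u = 0 := fun u hu ↦ by
    unfold soninProjection
    exact (Submodule.starProjection_apply_eq_zero_iff _).2 (hKorth hu)
  -- the target vector `y = Px − 𝐒x`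
  set y : Lp ℂ 2 (volume : Measure ℝ) := outerProj x - soninProjection 1 1 x with hy
  have hSx : soninProjection 1 1 x ∈ soninSpace 1 1 := soninProjection_mem 1 1 x
  have hyev : y ∈ evenPart :=
    evenPart.sub_mem (outerProj_mem_evenPart hx) (soninSpace_le_evenPart 1 1 hSx)
  have hy1 : cutoffProj 1 y = 0 := by
    rw [hy, map_sub, cutoffProj_outerProj, (mem_soninSpace_iff_cutoffProj.1 hSx).2.1, sub_self]
  have hyorth : y ∈ (soninSpace 1 1)ᗮ := by
    rw [Submodule.mem_orthogonal]
    intro s hs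
    obtain ⟨-, hs1, -⟩ := mem_soninSpace_iff_cutoffProj.1 hs
    rw [hy, inner_sub_right, ← inner_map_comm isStarProjection_outerProj'.isSelfAdjoint,
      outerProj_eq_self_of_cutoffProj_eq_zero hs1]
    unfold soninProjection
    rw [← Submodule.inner_starProjection_left_eq_right,
      Submodule.starProjection_eq_self_iff.2 hs, sub_self]
  -- completeness: `y ∈ K`
  have hyK : y ∈ K := by
    set z := y - K.starProjection y with hz
    have hzo : z ∈ Kᗮ := Submodule.sub_starProjection_mem_orthogonal y
    have hPy : K.starProjection y ∈ K := Submodule.starProjection_apply_mem K y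
    have hzev : z ∈ evenPart := evenPart.sub_mem hyev (hKev hPy)
    have hz1 : cutoffProj 1 z = 0 := by rw [hz, map_sub, hy1, hKker _ hPy, sub_self]
    have hzfix : outerProj z = z := outerProj_eq_self_of_cutoffProj_eq_zero hz1
    have hz2 : cutoffProjHat 1 z = 0 := by
      have hs := hasSum_inner_smul_prolateEta_of_xi_complete h hzev
      have hcoef : ∀ n : ℕ, ⟪prolateEta n, z⟫_ℂ = 0 := by
        intro n
        rw [← hzfix, ← inner_map_comm isStarProjection_outerProj'.isSelfAdjoint,
          show outerProj (prolateEta n) = prolatePsi n from rfl, prolatePsi_eq_smul_prolateZeta,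
          inner_smul_left]
        have : ⟪prolateZeta n, z⟫_ℂ = 0 :=
          Submodule.inner_right_of_mem_orthogonal (hmemK n) hzo
        rw [this, mul_zero]
      have h0 : (fun n : ℕ ↦ ⟪prolateEta n, z⟫_ℂ • prolateEta n) = fun _ ↦ 0 := by
        funext n
        rw [hcoef n, zero_smul]
      rw [h0] at hs
      exact hs.unique hasSum_zero
    have hzS : z ∈ soninSpace 1 1 := mem_soninSpace_iff_cutoffProj.2 ⟨hzev, hz1, hz2⟩
    have hzSo : z ∈ (soninSpace 1 1)ᗮ := (soninSpace 1 1)ᗮ.sub_mem hyorth (hKorth hPy)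
    have hz0 : z = 0 := by
      have := Submodule.inner_right_of_mem_orthogonal hzS hzSo
      exact inner_self_eq_zero.1 this
    have : y = K.starProjection y := (sub_eq_zero.1 (hz ▸ hz0 : y - K.starProjection y = 0))
    rw [this]
    exact hPy
  -- identification of the projection
  have hproj : K.starProjection x = y := by
    refine Submodule.eq_starProjection_of_mem_of_inner_eq_zero hyK fun w hw ↦ ?_
    have e : x - y = cutoffProj 1 x + soninProjection 1 1 x := by
      rw [hy, outerProj_apply]; abel
    rw [e, inner_add_left, inner_map_comm (cutoffProj_isSelfAdjoint 1), hKker w hw, inner_zero_right,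
      zero_add]
    unfold soninProjection
    rw [Submodule.inner_starProjection_left_eq_right]
    have := hSK w hw
    unfold soninProjection at this
    rw [this, inner_zero_right]
  rw [hproj] at hsum
  exact hsum

/-- **Connes–Consani 2021, eq. (spectral) from completeness of the prolate basis**:
`CC2021_sec4_xi_complete → CC2021_prop_4_5_spectral`, i.e. on `L²(ℝ)_ev`,
`P P̂ P = Σ_n λ(n)² |ζ_n⟩⟨ζ_n| + 𝐒` (vector-wise `HasSum`): combine `PP̂P = P − P𝒫̂₁P`,
`P𝒫̂₁P = Σ|ψ_n⟩⟨ψ_n| = Σ (1 − λ(n)²)|ζ_n⟩⟨ζ_n|` and `P − 𝐒 = Σ|ζ_n⟩⟨ζ_n|`.  This is the hypothesis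
`hsp`/`hQ` of the apex assembly (`SoninTraceReduction.hasSum_sq_inner_prolateZeta_of_prop_4_5_spectral`,
`ArchimedeanTraceFormulaProofs.CC2021_thm_4_7_weak_of_traces`), now reduced to the single named fact
`CC2021_sec4_xi_complete`. [cite: ConnesConsani2021, Prop. 4.5 (iii) proof §4 p. 17 eq. (spectral) (chunk p0017:L59–L63); Thm. 4.7 proof p. 18 eq. (sonine2) (chunk p0018:L77–L79)] -/
theorem CC2021_prop_4_5_spectral_of_xi_complete (h : CC2021_sec4_xi_complete) :
    CC2021_prop_4_5_spectral := by
  intro ξ hξ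
  have hζ := hasSum_inner_smul_prolateZeta_of_xi_complete h hξ
  have hψ := hasSum_inner_smul_prolatePsi_of_xi_complete h hξ
  have hpos : ∀ n : ℕ, 0 ≤ 1 - prolateEigen n ^ 2 := fun n ↦ by
    have h := abs_prolateEigen_lt_one n
    nlinarith [abs_nonneg (prolateEigen n), sq_abs (prolateEigen n)]
  have hterm : ∀ n : ℕ, ⟪prolatePsi n, ξ⟫_ℂ • prolatePsi n =
      ((1 - prolateEigen n ^ 2 : ℝ) : ℂ) • (⟪prolateZeta n, ξ⟫_ℂ • prolateZeta n) := by
    intro n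
    rw [prolatePsi_eq_smul_prolateZeta, inner_smul_left, Complex.conj_ofReal, smul_smul, smul_smul,
      mul_right_comm, ← Complex.ofReal_mul, Real.mul_self_sqrt (hpos n)]
  have hsub := hζ.sub hψ
  rw [outerProj_outerProjHat_outerProj_eq_sub]
  convert hsub using 1
  · funext n
    rw [hterm n, smul_smul, ← sub_smul]
    congr 1
    push_cast
    ring
  · abel

end Expansions

/-! ## Remark 4.6 (i) from completeness: `Tr(𝒫̂₁𝒫₁) = Σ λ(n)² = δ(1)` in the `L²((0,1])` model

Printed argument (Remark 4.6 (i), p. 18 with Prop. 4.5 (ii) at `ρ = 1` and Lemma 4.1): in the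
orthonormal basis `ξ_n` of `𝒫₁L²(ℝ)_ev ≅ L²([−1,1])_ev ≅ L²((0,1])` (`f ↦ √2 f|_{(0,1]}`),
`‖𝒫̂₁ξ_n‖² = ‖𝒫₁𝒫̂₁ξ_n‖² + ‖Pψ…‖²`… — we use the shorter road through the tree's Hilbert–Schmidt
toolkit (`IntegralOperatorHilbertSchmidt.hasSum_integral_norm_sq_integral_kernel_mul`, Parseval in a
Hilbert basis + monotone convergence): the operator `L²((0,1]) → L²((0,1])` with kernel
`k(x,y) = 2cos(2πxy)` maps `√2ξ_n|` to `√2λ(n)ξ_n|` ((cosalphan): t3's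
`IsProlateFunction.integral_mul_cos_eq_mul`), so `Σ_n λ(n)² = Σ_n ‖T_k e_n‖² = ∫∫_{[0,1]²} 4cos²(2πxy)
= 4∫_Δ… = δ(1)` (Lemma 2.1 (i): t1's `CC2021_prop_2_2_i_holds`).  Completeness of `(√2ξ_n|)` in
`L²((0,1])` is transported from `CC2021_sec4_xi_complete` along the even extension. -/

section TraceModel

/-- Folding an even integrand over `[−1, 1]`. [folklore] -/
private theorem intervalIntegral_symm_of_even {E : Type*} [NormedAddCommGroup E] [NormedSpace ℝ E]
    {f : ℝ → E} (hf : ∀ x, f (-x) = f x)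
    (h1 : IntervalIntegrable f volume (-1) 0) (h2 : IntervalIntegrable f volume 0 1) :
    ∫ x in (-1 : ℝ)..1, f x = (∫ x in (0 : ℝ)..1, f x) + ∫ x in (0 : ℝ)..1, f x := by
  rw [← intervalIntegral.integral_add_adjacent_intervals h1 h2]
  congr 1
  have h := intervalIntegral.integral_comp_neg (a := (0 : ℝ)) (b := 1) f
  rw [neg_zero] at h
  rw [← h]
  exact intervalIntegral.integral_congr fun x _ ↦ hf x

/-- The reflection isometry acts a.e. as `x ↦ u(−x)`. [folklore] -/
private theorem coeFn_reflect (u : Lp ℂ 2 (volume : Measure ℝ)) :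
    ((Lp.compMeasurePreservingₗᵢ ℂ (fun x : ℝ ↦ -x)
        (Measure.measurePreserving_neg (volume : Measure ℝ)) u : Lp ℂ 2 (volume : Measure ℝ)) : ℝ → ℂ)
      =ᵐ[volume] fun x ↦ (u : ℝ → ℂ) (-x) :=
  Lp.coeFn_compMeasurePreserving u (Measure.measurePreserving_neg (volume : Measure ℝ))

/-- `prolateFun n` is continuous on every sub-interval of `[−1, 1]` (helper). [cite: ConnesConsani2021, §4 p. 16 (chunk p0016:L17–L28)] -/
private theorem continuousOn_prolateFun_of_subset (n : ℕ) {s : Set ℝ} (hs : s ⊆ Icc (-1 : ℝ) 1) :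
    ContinuousOn (prolateFun n) s :=
  (isProlateFunction_prolateFun n).contDiffOn.continuousOn.mono hs

/-- **`e_n := √2 ξ_n|_{(0,1]} ∈ L²((0,1])`.** [cite: ConnesConsani2021, Remark 4.6 (i) §4 p. 18 (chunk p0018:L20–L30)] -/
theorem memLp_sqrt_two_mul_prolateXiFun_restrict (n : ℕ) :
    MemLp (fun x ↦ ((Real.sqrt 2 : ℝ) : ℂ) * prolateXiFun n x) 2
      ((volume : Measure ℝ).restrict (Ioc (0 : ℝ) 1)) :=
  ((memLp_prolateXiFun n).restrict (Ioc (0 : ℝ) 1)).const_mul _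

/-- **`⟨e_n | e_m⟩_{L²((0,1])} = ⟨ξ_n | ξ_m⟩_{L²(ℝ)}`** (`2∫_0^1 h_n h_m = ∫_{−1}^{1} h_n h_m`, evenness).
[cite: ConnesConsani2021, Remark 4.6 (i) §4 p. 18 (chunk p0018:L20–L30); Prop. 4.5 proof p. 17 (chunk p0017:L2)] -/
theorem inner_toLp_sqrt_two_mul_prolateXiFun (n m : ℕ) :
    ⟪((memLp_sqrt_two_mul_prolateXiFun_restrict n).toLp _ :
        Lp ℂ 2 ((volume : Measure ℝ).restrict (Ioc (0 : ℝ) 1))),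
      (memLp_sqrt_two_mul_prolateXiFun_restrict m).toLp _⟫_ℂ = ⟪prolateXi n, prolateXi m⟫_ℂ := by
  rw [inner_prolateXi, L2.inner_def]
  have h2 : ((Real.sqrt 2 : ℝ) : ℂ) * ((Real.sqrt 2 : ℝ) : ℂ) = 2 := by
    rw [← Complex.ofReal_mul, Real.mul_self_sqrt zero_le_two]; norm_num
  have h1 : ∫ x, ⟪((memLp_sqrt_two_mul_prolateXiFun_restrict n).toLp _ :
        Lp ℂ 2 ((volume : Measure ℝ).restrict (Ioc (0 : ℝ) 1))) x,
      ((memLp_sqrt_two_mul_prolateXiFun_restrict m).toLp _ :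
        Lp ℂ 2 ((volume : Measure ℝ).restrict (Ioc (0 : ℝ) 1))) x⟫_ℂ
        ∂((volume : Measure ℝ).restrict (Ioc (0 : ℝ) 1))
      = ∫ x in Ioc (0 : ℝ) 1, ((2 * (prolateFun n x * prolateFun m x) : ℝ) : ℂ) := by
    refine integral_congr_ae ?_
    filter_upwards [(memLp_sqrt_two_mul_prolateXiFun_restrict n).coeFn_toLp,
      (memLp_sqrt_two_mul_prolateXiFun_restrict m).coeFn_toLp] with x hx hy
    rw [hx, hy]
    simp only [prolateXiFun, RCLike.inner_apply, map_mul, Complex.conj_ofReal]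
    push_cast
    linear_combination ((prolateFun n x : ℂ) * (prolateFun m x : ℂ)) * h2
  rw [h1, integral_complex_ofReal]
  congr 1
  have hc : ContinuousOn (fun x ↦ prolateFun n x * prolateFun m x) (Icc (-1 : ℝ) 1) :=
    (continuousOn_prolateFun_of_subset n subset_rfl).mul (continuousOn_prolateFun_of_subset m subset_rfl)
  rw [← intervalIntegral.integral_of_le zero_le_one, intervalIntegral.integral_const_mul,
    intervalIntegral_symm_of_even (f := fun x ↦ prolateFun n x * prolateFun m x)
      (fun x ↦ by simp only [prolateFun_neg])
      ((hc.mono (Icc_subset_Icc le_rfl zero_le_one)).intervalIntegrable_of_Icc (by norm_num))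
      ((hc.mono (Icc_subset_Icc (by norm_num) le_rfl)).intervalIntegrable_of_Icc zero_le_one)]
  ring

/-- **The `e_n = √2 ξ_n|_{(0,1]}` are orthonormal in `L²((0,1])`.** [cite: ConnesConsani2021, Remark 4.6 (i) §4 p. 18 (chunk p0018:L20–L30); Prop. 4.5 proof p. 17 (chunk p0017:L2)] -/
theorem orthonormal_toLp_sqrt_two_mul_prolateXiFun :
    Orthonormal ℂ (fun n : ℕ ↦ ((memLp_sqrt_two_mul_prolateXiFun_restrict n).toLp _ :
      Lp ℂ 2 ((volume : Measure ℝ).restrict (Ioc (0 : ℝ) 1)))) := by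
  classical
  have hon : Orthonormal ℂ prolateXi := CC2021_sec4_xi_orthonormal_holds
  rw [orthonormal_iff_ite] at hon ⊢
  intro n m
  rw [inner_toLp_sqrt_two_mul_prolateXiFun, hon n m]

/-- **Completeness transport**: if `CC2021_sec4_xi_complete` holds, the `e_n = √2 ξ_n|_{(0,1]}` span a
dense subspace of `L²((0,1])` (a `g ∈ L²((0,1])` orthogonal to all `e_n` has even extension
`G ∈ 𝒫₁L²(ℝ)_ev` orthogonal to all `ξ_n`, hence `G = 0`, hence `g = 0`).
[cite: ConnesConsani2021, Prop. 4.5 (ii) proof §4 p. 17 (chunk p0017:L2–L4); Remark 4.6 (i) p. 18] -/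
theorem orthogonal_span_toLp_sqrt_two_mul_prolateXiFun_eq_bot (h : CC2021_sec4_xi_complete) :
    (span ℂ (Set.range (fun n : ℕ ↦ ((memLp_sqrt_two_mul_prolateXiFun_restrict n).toLp _ :
      Lp ℂ 2 ((volume : Measure ℝ).restrict (Ioc (0 : ℝ) 1))))))ᗮ = ⊥ := by
  rw [Submodule.eq_bot_iff]
  intro g hg
  have hg' : ∀ n : ℕ, ⟪((memLp_sqrt_two_mul_prolateXiFun_restrict n).toLp _ :
      Lp ℂ 2 ((volume : Measure ℝ).restrict (Ioc (0 : ℝ) 1))), g⟫_ℂ = 0 := fun n ↦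
    (Submodule.mem_orthogonal _ _).1 hg _ (subset_span ⟨n, rfl⟩)
  -- the extension of `g` by zero, and its even extension `G`
  have hneg := Measure.measurePreserving_neg (volume : Measure ℝ)
  have hG0m : MemLp ((Ioc (0 : ℝ) 1).indicator (g : ℝ → ℂ)) 2 (volume : Measure ℝ) :=
    (memLp_indicator_iff_restrict measurableSet_Ioc).2 (Lp.memLp g)
  set G0 : Lp ℂ 2 (volume : Measure ℝ) := hG0m.toLp _ with hG0def
  set R : Lp ℂ 2 (volume : Measure ℝ) →ₗᵢ[ℂ] Lp ℂ 2 (volume : Measure ℝ) :=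
    Lp.compMeasurePreservingₗᵢ ℂ (fun x : ℝ ↦ -x) hneg with hRdef
  have hG0c : (G0 : ℝ → ℂ) =ᵐ[volume] (Ioc (0 : ℝ) 1).indicator (g : ℝ → ℂ) := hG0m.coeFn_toLp
  have hRc : ∀ u : Lp ℂ 2 (volume : Measure ℝ), ((R u : Lp ℂ 2 (volume : Measure ℝ)) : ℝ → ℂ)
      =ᵐ[volume] fun x ↦ (u : ℝ → ℂ) (-x) := fun u ↦ coeFn_reflect u
  have hRR : ∀ u : Lp ℂ 2 (volume : Measure ℝ), R (R u) = u := fun u ↦ by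
    apply Lp.ext
    have h1 := hRc (R u)
    have h2 := hneg.quasiMeasurePreserving.ae_eq_comp (hRc u)
    filter_upwards [h1, h2] with x hx hx'
    simp only [Function.comp_apply, neg_neg] at hx'
    rw [hx, hx']
  have hRadj : ∀ u v : Lp ℂ 2 (volume : Measure ℝ), ⟪u, R v⟫_ℂ = ⟪R u, v⟫_ℂ := fun u v ↦ by
    rw [← R.inner_map_map u (R v), hRR]
  set G : Lp ℂ 2 (volume : Measure ℝ) := G0 + R G0 with hGdef
  have hGc : (G : ℝ → ℂ) =ᵐ[volume]
      fun x ↦ (Ioc (0 : ℝ) 1).indicator (g : ℝ → ℂ) x + (Ioc (0 : ℝ) 1).indicator (g : ℝ → ℂ) (-x) := by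
    have h2 := hneg.quasiMeasurePreserving.ae_eq_comp hG0c
    filter_upwards [Lp.coeFn_add G0 (R G0), hRc G0, hG0c, h2] with x h1 h3 h4 h5
    simp only [Function.comp_apply] at h5
    rw [h1, Pi.add_apply, h3, h4, h5]
  -- `G` is even, supported in `[−1, 1]`, and orthogonal to every `ξ_n`
  have hGev : G ∈ evenPart := by
    rw [mem_evenPart_iff]
    have h2 := hneg.quasiMeasurePreserving.ae_eq_comp hGc
    filter_upwards [hGc, h2] with x h1 h3
    simp only [Function.comp_apply, neg_neg] at h3
    rw [h3, h1, add_comm]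
  have hGcut : cutoffProj 1 G = G := by
    apply Lp.ext
    filter_upwards [cutoffProj_coeFn 1 G, hGc] with x h1 h2
    rw [h1]
    by_cases hx : x ∈ Icc (-1 : ℝ) 1
    · rw [indicator_of_mem hx]
    · rw [indicator_of_notMem hx, h2]
      rw [mem_Icc, not_and_or, not_le, not_le] at hx
      have hx1 : x ∉ Ioc (0 : ℝ) 1 := fun hh ↦ by
        rcases hx with hx | hx
        · linarith [hh.1]
        · linarith [hh.2]
      have hx2 : -x ∉ Ioc (0 : ℝ) 1 := fun hh ↦ by
        rcases hx with hx | hx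
        · linarith [hh.2]
        · linarith [hh.1]
      rw [indicator_of_notMem hx1, indicator_of_notMem hx2, add_zero]
  have hG0inner : ∀ n : ℕ, ⟪prolateXi n, G0⟫_ℂ =
      (((Real.sqrt 2)⁻¹ : ℝ) : ℂ) * ⟪((memLp_sqrt_two_mul_prolateXiFun_restrict n).toLp _ :
        Lp ℂ 2 ((volume : Measure ℝ).restrict (Ioc (0 : ℝ) 1))), g⟫_ℂ := by
    intro n
    have hs2 : Real.sqrt 2 ≠ 0 := (Real.sqrt_pos.2 two_pos).ne'
    rw [L2.inner_def, L2.inner_def]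
    have e1 : ∫ x, ⟪(prolateXi n : ℝ → ℂ) x, (G0 : ℝ → ℂ) x⟫_ℂ =
        ∫ x, (Ioc (0 : ℝ) 1).indicator (fun x ↦ g x * (starRingEnd ℂ) (prolateXiFun n x)) x := by
      refine integral_congr_ae ?_
      filter_upwards [prolateXi_coeFn n, hG0c] with x hx hy
      rw [hx, hy, RCLike.inner_apply]
      by_cases hx' : x ∈ Ioc (0 : ℝ) 1
      · rw [indicator_of_mem hx', indicator_of_mem hx']
      · rw [indicator_of_notMem hx', indicator_of_notMem hx', zero_mul]
    have e2 : ∫ x, ⟪(((memLp_sqrt_two_mul_prolateXiFun_restrict n).toLp _ :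
          Lp ℂ 2 ((volume : Measure ℝ).restrict (Ioc (0 : ℝ) 1))) : ℝ → ℂ) x, (g : ℝ → ℂ) x⟫_ℂ
          ∂((volume : Measure ℝ).restrict (Ioc (0 : ℝ) 1))
        = ((Real.sqrt 2 : ℝ) : ℂ) * ∫ x in Ioc (0 : ℝ) 1, g x * (starRingEnd ℂ) (prolateXiFun n x) := by
      rw [← integral_const_mul]
      refine integral_congr_ae ?_
      filter_upwards [(memLp_sqrt_two_mul_prolateXiFun_restrict n).coeFn_toLp] with x hx
      rw [hx, RCLike.inner_apply, map_mul, Complex.conj_ofReal]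
      ring
    rw [e1, integral_indicator measurableSet_Ioc, e2, ← mul_assoc, ← Complex.ofReal_mul,
      inv_mul_cancel₀ hs2, Complex.ofReal_one, one_mul]
  have hGinner : ∀ n : ℕ, ⟪prolateXi n, G⟫_ℂ = 0 := by
    intro n
    have hRxi : R (prolateXi n) = prolateXi n :=
      Lp.ext ((hRc (prolateXi n)).trans (mem_evenPart_iff.1 (prolateXi_mem_evenPart n)))
    rw [hGdef, inner_add_right, hRadj, hRxi, hG0inner n, hg' n, mul_zero, add_zero]
  -- completeness of `(ξ_n)` in `𝒫₁L²(ℝ)_ev` kills `G`, hence `g`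
  have hG : G = 0 := h G hGev hGcut hGinner
  apply Lp.ext
  have hz : (G : ℝ → ℂ) =ᵐ[volume] 0 := by
    rw [hG]
    exact Lp.coeFn_zero ℂ 2 volume
  have hae : ∀ᵐ x ∂(volume : Measure ℝ), x ∈ Ioc (0 : ℝ) 1 → (g : ℝ → ℂ) x = 0 := by
    filter_upwards [hGc, hz] with x h1 h2 hx
    have hx2 : -x ∉ Ioc (0 : ℝ) 1 := fun hh ↦ by linarith [hh.1, hx.1]
    have := h1.symm.trans h2
    rwa [indicator_of_mem hx, indicator_of_notMem hx2, add_zero] at this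
  filter_upwards [(ae_restrict_iff' measurableSet_Ioc).2 hae,
    Lp.coeFn_zero ℂ 2 ((volume : Measure ℝ).restrict (Ioc (0 : ℝ) 1))] with x h1 h2
  rw [h1, h2, Pi.zero_apply]

/-- **(cosalphan) in the model**: the kernel `2cos(2πxy)` on `(0,1]²` maps `e_n = √2ξ_n|` to
`√2 λ(n) ξ_n|`: for `x ∈ [−1, 1]`, `∫_{(0,1]} 2cos(2πxy) √2 h_n(y) dy = √2 λ(n) h_n(x)`.
[cite: ConnesConsani2021, §4 p. 16 eq. (cosalphan) (chunk p0016:L25–L28); Remark 4.6 (i) p. 18] -/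
theorem integral_Ioc_cos_kernel_mul_prolateFun (n : ℕ) {x : ℝ} (hx : x ∈ Icc (-1 : ℝ) 1) :
    ∫ y in Ioc (0 : ℝ) 1, 2 * Real.cos (2 * π * y * x) * (Real.sqrt 2 * prolateFun n y)
      = Real.sqrt 2 * (prolateEigen n * prolateFun n x) := by
  have hf := isProlateFunction_prolateFun n
  have key := hf.integral_mul_cos_eq_mul hx
  rw [← prolateEigen_eq_intervalIntegral] at key
  have hc : ContinuousOn (fun y ↦ prolateFun n y * Real.cos (2 * π * y * x)) (Icc (-1 : ℝ) 1) :=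
    (continuousOn_prolateFun_of_subset n subset_rfl).mul (by fun_prop)
  rw [intervalIntegral_symm_of_even (f := fun y ↦ prolateFun n y * Real.cos (2 * π * y * x))
      (fun y ↦ by rw [prolateFun_neg, show 2 * π * -y * x = -(2 * π * y * x) by ring, Real.cos_neg])
      ((hc.mono (Icc_subset_Icc le_rfl zero_le_one)).intervalIntegrable_of_Icc (by norm_num))
      ((hc.mono (Icc_subset_Icc (by norm_num) le_rfl)).intervalIntegrable_of_Icc zero_le_one),
    intervalIntegral.integral_of_le zero_le_one] at key
  have e : (fun y ↦ 2 * Real.cos (2 * π * y * x) * (Real.sqrt 2 * prolateFun n y))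
      = fun y ↦ (2 * Real.sqrt 2) * (prolateFun n y * Real.cos (2 * π * y * x)) := by
    funext y; ring
  rw [e, integral_const_mul]
  linear_combination Real.sqrt 2 * key

/-- **Remark 4.6 (i) from completeness of the prolate basis**:
`CC2021_sec4_xi_complete → CC2021_rem_4_6_i`, i.e. `Σ_n λ(n)² = δ(1)` (`= Tr(𝒫̂₁𝒫₁)`; the value
`δ(1) = 2Si(4π)/(4π) + 2 ≈ 2` is t1's closed form (25)).  Hilbert–Schmidt norm of the kernel
`2cos(2πxy)` on `L²((0,1])` in the Hilbert basis `√2ξ_n|_{(0,1]}`: `Σ‖T e_n‖² = Σ 2λ(n)²∫_0^1 h_n² = Σλ(n)²`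
and `∫∫ 4cos² = 4∫_Δ… = δ(1)` (t1's `CC2021_prop_2_2_i_holds` at `ρ = 1`).
[cite: ConnesConsani2021, Remark 4.6 (i) §4 p. 18 (arXiv item Remark 26 (i), chunk p0018:L20–L30); Lemma 4.1 p. 15; Lemma 2.1 (i) p. 10] -/
theorem CC2021_rem_4_6_i_of_xi_complete (h : CC2021_sec4_xi_complete) : CC2021_rem_4_6_i := by
  rw [CC2021_rem_4_6_i]
  haveI : IsFiniteMeasure ((volume : Measure ℝ).restrict (Ioc (0 : ℝ) 1)) :=
    isFiniteMeasure_restrict.2 measure_Ioc_lt_top.ne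
  set b : HilbertBasis ℕ ℂ (Lp ℂ 2 ((volume : Measure ℝ).restrict (Ioc (0 : ℝ) 1))) :=
    HilbertBasis.mkOfOrthogonalEqBot orthonormal_toLp_sqrt_two_mul_prolateXiFun
      (orthogonal_span_toLp_sqrt_two_mul_prolateXiFun_eq_bot h) with hbdef
  have hb : ∀ n : ℕ, (b n : Lp ℂ 2 ((volume : Measure ℝ).restrict (Ioc (0 : ℝ) 1)))
      = (memLp_sqrt_two_mul_prolateXiFun_restrict n).toLp _ := fun n ↦ by
    rw [hbdef, HilbertBasis.coe_mkOfOrthogonalEqBot]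
  set K : ℝ → ℝ → ℂ := fun x y ↦ ((2 * Real.cos (2 * π * y * x) : ℝ) : ℂ) with hKdef
  have hK : StronglyMeasurable (Function.uncurry K) := by
    apply Continuous.stronglyMeasurable
    simp only [hKdef, Function.uncurry_def]
    fun_prop
  have hC : ∀ x y, ‖K x y‖ ≤ 2 := fun x y ↦ by
    simp only [hKdef, Complex.norm_real, Real.norm_eq_abs, abs_mul, abs_two]
    nlinarith [Real.abs_cos_le_one (2 * π * y * x), abs_nonneg (Real.cos (2 * π * y * x))]
  have hs := hasSum_integral_norm_sq_integral_kernel_mul hK hC b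
  -- `‖T e_n‖² = λ(n)²`
  have hterm : ∀ n : ℕ, ∫ x, ‖∫ y, K x y * b n y ∂((volume : Measure ℝ).restrict (Ioc (0 : ℝ) 1))‖ ^ 2
      ∂((volume : Measure ℝ).restrict (Ioc (0 : ℝ) 1)) = prolateEigen n ^ 2 := by
    intro n
    have hin : ∀ x ∈ Icc (-1 : ℝ) 1,
        ∫ y, K x y * b n y ∂((volume : Measure ℝ).restrict (Ioc (0 : ℝ) 1))
          = ((Real.sqrt 2 * (prolateEigen n * prolateFun n x) : ℝ) : ℂ) := by
      intro x hx
      have e1 : ∫ y, K x y * b n y ∂((volume : Measure ℝ).restrict (Ioc (0 : ℝ) 1))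
          = ∫ y in Ioc (0 : ℝ) 1,
            ((2 * Real.cos (2 * π * y * x) * (Real.sqrt 2 * prolateFun n y) : ℝ) : ℂ) := by
        refine integral_congr_ae ?_
        rw [hb n]
        filter_upwards [(memLp_sqrt_two_mul_prolateXiFun_restrict n).coeFn_toLp] with y hy
        rw [hy]
        simp only [hKdef, prolateXiFun]
        push_cast
        ring
      rw [e1, integral_complex_ofReal, integral_Ioc_cos_kernel_mul_prolateFun n hx]
    have e2 : ∫ x, ‖∫ y, K x y * b n y ∂((volume : Measure ℝ).restrict (Ioc (0 : ℝ) 1))‖ ^ 2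
        ∂((volume : Measure ℝ).restrict (Ioc (0 : ℝ) 1))
        = ∫ x in Ioc (0 : ℝ) 1, (2 * prolateEigen n ^ 2) * prolateFun n x ^ 2 := by
      refine integral_congr_ae ((ae_restrict_iff' measurableSet_Ioc).2 (ae_of_all _ fun x hx ↦ ?_))
      dsimp only
      rw [hin x ⟨by linarith [hx.1], hx.2⟩, Complex.norm_real, Real.norm_eq_abs, sq_abs]
      have : Real.sqrt 2 ^ 2 = 2 := Real.sq_sqrt zero_le_two
      linear_combination (prolateEigen n * prolateFun n x) ^ 2 * this
    have hc : ContinuousOn (fun x ↦ prolateFun n x ^ 2) (Icc (-1 : ℝ) 1) :=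
      (continuousOn_prolateFun_of_subset n subset_rfl).pow 2
    rw [e2, integral_const_mul, ← intervalIntegral.integral_of_le zero_le_one]
    have hfold := intervalIntegral_symm_of_even (f := fun x ↦ prolateFun n x ^ 2)
      (fun x ↦ by rw [prolateFun_neg])
      ((hc.mono (Icc_subset_Icc le_rfl zero_le_one)).intervalIntegrable_of_Icc (by norm_num))
      ((hc.mono (Icc_subset_Icc (by norm_num) le_rfl)).intervalIntegrable_of_Icc zero_le_one)
    rw [(isProlateFunction_prolateFun n).norm_one] at hfold
    linear_combination (-(prolateEigen n ^ 2)) * hfold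
  -- `∫∫ |k|² = δ(1)`
  have hval : ∫ x, ∫ y, ‖K x y‖ ^ 2 ∂((volume : Measure ℝ).restrict (Ioc (0 : ℝ) 1))
      ∂((volume : Measure ℝ).restrict (Ioc (0 : ℝ) 1)) = traceRemainder 1 := by
    rw [CC2021_prop_2_2_i_holds 1 le_rfl, Real.sqrt_one, mul_one, deltaSquareIntegral,
      ← integral_const_mul]
    refine integral_congr_ae (ae_of_all _ fun x ↦ ?_)
    dsimp only
    rw [← integral_const_mul]
    refine integral_congr_ae (ae_of_all _ fun y ↦ ?_)
    dsimp only
    simp only [hKdef, Complex.norm_real, Real.norm_eq_abs, sq_abs, mul_one]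
    rw [show 2 * π * y * x = 2 * π * x * y by ring]
    ring
  convert hs using 1
  · funext n
    exact (hterm n).symm
  · exact hval.symm

end TraceModel

/-! ## Lemma 4.1 / Proposition 4.5 (ii) from completeness: `Tr(ϑ(ρ⁻¹)𝒫̂₁𝒫₁) = δ(ρ)` polarised in the
## `L²((0,1])` model -/

section TraceModelPolarised

/-- `∫_ℝ φ_n(v) k(v) dv = ∫_{−1}^{1} φ_n(v) k(v) dv` for a real weight (support of `φ_n`). [cite: ConnesConsani2021, §4 p. 16 (chunk p0016:L25–L27)] -/
private theorem integral_prolateFun_mul_real (n : ℕ) (k : ℝ → ℝ) :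
    ∫ v, prolateFun n v * k v = ∫ v in (-1 : ℝ)..1, prolateFun n v * k v := by
  have h : (fun v ↦ prolateFun n v * k v)
      = (Icc (-1 : ℝ) 1).indicator (fun v ↦ prolateFun n v * k v) := by
    funext v
    by_cases hv : v ∈ Icc (-1 : ℝ) 1
    · rw [indicator_of_mem hv]
    · rw [indicator_of_notMem hv, prolateFun_eq_zero_of_notMem hv, zero_mul]
  conv_lhs => rw [h]
  rw [integral_indicator measurableSet_Icc, integral_Icc_eq_integral_Ioc,
    ← intervalIntegral.integral_of_le (by norm_num : (-1 : ℝ) ≤ 1)]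

/-- `∫_ℝ φ_n(v) k(v) dv = ∫_{−1}^{1} φ_n(v) k(v) dv` for a complex weight. [cite: ConnesConsani2021, §4 p. 16 (chunk p0016:L25–L27)] -/
private theorem integral_prolateFun_mul_complex (n : ℕ) (k : ℝ → ℂ) :
    ∫ v, (prolateFun n v : ℂ) * k v = ∫ v in (-1 : ℝ)..1, (prolateFun n v : ℂ) * k v := by
  have h : (fun v ↦ (prolateFun n v : ℂ) * k v)
      = (Icc (-1 : ℝ) 1).indicator (fun v ↦ (prolateFun n v : ℂ) * k v) := by
    funext v
    by_cases hv : v ∈ Icc (-1 : ℝ) 1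
    · rw [indicator_of_mem hv]
    · rw [indicator_of_notMem hv, prolateFun_eq_zero_of_notMem hv]; simp
  conv_lhs => rw [h]
  rw [integral_indicator measurableSet_Icc, integral_Icc_eq_integral_Ioc,
    ← intervalIntegral.integral_of_le (by norm_num : (-1 : ℝ) ≤ 1)]

/-- **`η_n` as a cosine transform, for every real argument**: `η_n(u) = ∫_{−1}^{1} h_n(x) cos(2πxu) dx`
(`η_n = 𝔽_{e_ℝ}ξ_n` with `ξ_n` real and even: the sine part vanishes).  For `|u| ≤ 1` this is
`λ(n)h_n(u)` ((cosalphan), t3's `prolateEtaFun_eq_of_mem`); here no restriction on `u`.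
[cite: ConnesConsani2021, §4 p. 16 eq. (prolateeq) (chunk p0016:L17–L24); Prop. 4.5 (ii) proof p. 17] -/
theorem prolateEtaFun_eq_integral_cos (n : ℕ) (u : ℝ) :
    prolateEtaFun n u = ((∫ x in (-1 : ℝ)..1, prolateFun n x * Real.cos (2 * π * x * u) : ℝ) : ℂ) := by
  have hf := isProlateFunction_prolateFun n
  have hfc : ContinuousOn (prolateFun n) (Icc (-1 : ℝ) 1) := hf.contDiffOn.continuousOn
  set ω : ℝ := -u with hω
  have hsin : ∫ x in (-1 : ℝ)..1, prolateFun n x * Real.sin (2 * π * x * ω) = 0 := by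
    have h1 : (∫ x in (-1 : ℝ)..1, prolateFun n (-x) * Real.sin (2 * π * (-x) * ω))
        = ∫ x in (-1 : ℝ)..1, prolateFun n x * Real.sin (2 * π * x * ω) := by
      simpa only [neg_neg] using intervalIntegral.integral_comp_neg (a := (-1 : ℝ)) (b := 1)
        (fun x ↦ prolateFun n x * Real.sin (2 * π * x * ω))
    have h2 : (∫ x in (-1 : ℝ)..1, prolateFun n (-x) * Real.sin (2 * π * (-x) * ω))
        = -∫ x in (-1 : ℝ)..1, prolateFun n x * Real.sin (2 * π * x * ω) := by
      rw [← intervalIntegral.integral_neg]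
      refine intervalIntegral.integral_congr fun x _ ↦ ?_
      simp only [prolateFun_neg]
      rw [show 2 * π * (-x) * ω = -(2 * π * x * ω) by ring, Real.sin_neg]
      ring
    linarith
  have hc1 : ContinuousOn (fun x : ℝ ↦ ((prolateFun n x * Real.cos (2 * π * x * ω) : ℝ) : ℂ))
      (Icc (-1 : ℝ) 1) :=
    Complex.continuous_ofReal.comp_continuousOn (hfc.mul (by fun_prop))
  have hc2 : ContinuousOn (fun x : ℝ ↦ ((prolateFun n x * Real.sin (2 * π * x * ω) : ℝ) : ℂ) * I)
      (Icc (-1 : ℝ) 1) :=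
    (Complex.continuous_ofReal.comp_continuousOn (hfc.mul (by fun_prop))).mul continuousOn_const
  have hint : ∫ x in (-1 : ℝ)..1, (prolateFun n x : ℂ) * cexp (2 * π * I * x * ω)
      = ((∫ x in (-1 : ℝ)..1, prolateFun n x * Real.cos (2 * π * x * ω) : ℝ) : ℂ)
        + ((∫ x in (-1 : ℝ)..1, prolateFun n x * Real.sin (2 * π * x * ω) : ℝ) : ℂ) * I := by
    have e : (fun x : ℝ ↦ (prolateFun n x : ℂ) * cexp (2 * π * I * x * ω))
        = fun x : ℝ ↦ ((prolateFun n x * Real.cos (2 * π * x * ω) : ℝ) : ℂ)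
          + ((prolateFun n x * Real.sin (2 * π * x * ω) : ℝ) : ℂ) * I := by
      funext x
      have : (2 * π * I * x * ω : ℂ) = ((2 * π * x * ω : ℝ) : ℂ) * I := by push_cast; ring
      rw [this, Complex.exp_mul_I, ← Complex.ofReal_cos, ← Complex.ofReal_sin]
      push_cast; ring
    rw [e, intervalIntegral.integral_add (hc1.intervalIntegrable_of_Icc (by norm_num))
        (hc2.intervalIntegrable_of_Icc (by norm_num)), intervalIntegral.integral_mul_const,
      intervalIntegral.integral_ofReal, intervalIntegral.integral_ofReal]
  rw [prolateEtaFun, Real.fourier_real_eq_integral_exp_smul]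
  have e : (fun v : ℝ ↦ cexp (↑(-2 * π * v * u) * I) • prolateXiFun n v)
      = fun v : ℝ ↦ (prolateFun n v : ℂ) * cexp (2 * π * I * v * ω) := by
    funext v
    simp only [prolateXiFun, smul_eq_mul, hω]
    rw [mul_comm]
    congr 2
    push_cast; ring
  rw [e, integral_prolateFun_mul_complex, hint, hsin]
  have hcos : (fun x ↦ prolateFun n x * Real.cos (2 * π * x * ω))
      = fun x ↦ prolateFun n x * Real.cos (2 * π * x * u) := by
    funext x
    rw [hω, show 2 * π * x * -u = -(2 * π * x * u) by ring, Real.cos_neg]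
  rw [hcos]
  push_cast
  ring

/-- `η_n` is an even function. [cite: ConnesConsani2021, Prop. 4.5 (ii) proof §4 p. 17 (chunk p0017:L5–L10)] -/
theorem prolateEtaFun_neg (n : ℕ) (u : ℝ) : prolateEtaFun n (-u) = prolateEtaFun n u := by
  rw [prolateEtaFun_eq_integral_cos, prolateEtaFun_eq_integral_cos]
  congr 1
  refine intervalIntegral.integral_congr fun x _ ↦ ?_
  rw [show 2 * π * x * -u = -(2 * π * x * u) by ring, Real.cos_neg]

/-- The kernel `2cos(2πyω)` against `√2 h_n` on `(0,1]`, for every `ω`: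
`∫_{(0,1]} 2cos(2πyω) √2h_n(y) dy = √2 ∫_{−1}^{1} h_n(y)cos(2πyω) dy` (evenness).
[cite: ConnesConsani2021, §4 p. 16 eq. (prolateeq) (chunk p0016:L17–L24); Lemma 4.1 proof p. 15] -/
theorem integral_Ioc_cos_kernel_mul_prolateFun_eq (n : ℕ) (ω : ℝ) :
    ∫ y in Ioc (0 : ℝ) 1, 2 * Real.cos (2 * π * y * ω) * (Real.sqrt 2 * prolateFun n y)
      = Real.sqrt 2 * ∫ y in (-1 : ℝ)..1, prolateFun n y * Real.cos (2 * π * y * ω) := by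
  have hc : ContinuousOn (fun y ↦ prolateFun n y * Real.cos (2 * π * y * ω)) (Icc (-1 : ℝ) 1) :=
    (continuousOn_prolateFun_of_subset n subset_rfl).mul (by fun_prop)
  rw [intervalIntegral_symm_of_even (f := fun y ↦ prolateFun n y * Real.cos (2 * π * y * ω))
      (fun y ↦ by rw [prolateFun_neg, show 2 * π * -y * ω = -(2 * π * y * ω) by ring, Real.cos_neg])
      ((hc.mono (Icc_subset_Icc le_rfl zero_le_one)).intervalIntegrable_of_Icc (by norm_num))
      ((hc.mono (Icc_subset_Icc (by norm_num) le_rfl)).intervalIntegrable_of_Icc zero_le_one),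
    intervalIntegral.integral_of_le zero_le_one]
  have e : (fun y ↦ 2 * Real.cos (2 * π * y * ω) * (Real.sqrt 2 * prolateFun n y))
      = fun y ↦ (2 * Real.sqrt 2) * (prolateFun n y * Real.cos (2 * π * y * ω)) := by
    funext y; ring
  rw [e, integral_const_mul]
  ring

/-- **`Σ_n λ(n)⟨ξ_n|ϑ(ρ⁻¹)η_n⟩ = δ(ρ)` for `ρ ≥ 1`, from completeness** (the common content of
Lemma 4.1 `Tr(ϑ(ρ⁻¹)𝒫̂₁𝒫₁) = δ(ρ)` and Prop. 4.5 (ii), since `𝒫̂₁𝒫₁ξ_n = λ(n)η_n`).  In the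
`L²((0,1])` model with Hilbert basis `e_n = √2ξ_n|`: the kernels `b = 2cos(2πxy)` and
`a = 2ρ^{1/2}cos(2πρxy)` give `T_b e_n = √2λ(n)h_n`, `(T_a e_n)(x) = √2 ρ^{1/2} η_n(ρx)`, so
`Re⟨T_b e_n, T_a e_n⟩ = λ(n)⟨ξ_n|ϑ(ρ⁻¹)η_n⟩`; summing by polarisation of the tree's Hilbert–Schmidt
identity (kernels `b ± a`): `Σ_n = ∫∫ b·a = 4ρ^{1/2}∫∫_{[0,1]²}cos(2πρxy)cos(2πxy) = δ(ρ)` (Lemma 2.1 (i)).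
[cite: ConnesConsani2021, Lemma 4.1 §4 p. 15 (chunk p0015:L60–L75); Prop. 4.5 (ii) proof p. 17 (chunk p0017:L5–L12); Lemma 2.1 (i) p. 10] -/
theorem hasSum_prolateEigen_mul_repCoeff_of_xi_complete (h : CC2021_sec4_xi_complete) {ρ : ℝ}
    (hρ : 1 ≤ ρ) :
    HasSum (fun n : ℕ ↦ (prolateEigen n : ℂ) * repCoeff (prolateXiFun n) (prolateEtaFun n) ρ)
      ((traceRemainder ρ : ℝ) : ℂ) := by
  have hρ0 : 0 < ρ := by linarith
  have hsρ : 0 ≤ Real.sqrt ρ := Real.sqrt_nonneg ρ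
  haveI : IsFiniteMeasure ((volume : Measure ℝ).restrict (Ioc (0 : ℝ) 1)) :=
    isFiniteMeasure_restrict.2 measure_Ioc_lt_top.ne
  -- integrability on `(0,1]` of functions continuous on `[0,1]`
  have hIo : ∀ {f : ℝ → ℝ}, ContinuousOn f (Icc (0 : ℝ) 1) →
      Integrable f ((volume : Measure ℝ).restrict (Ioc (0 : ℝ) 1)) := fun hf ↦
    (hf.integrableOn_compact isCompact_Icc).mono_set Ioc_subset_Icc_self
  have hhc : ∀ n : ℕ, ContinuousOn (prolateFun n) (Icc (0 : ℝ) 1) := fun n ↦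
    continuousOn_prolateFun_of_subset n (Icc_subset_Icc (by norm_num) le_rfl)
  -- the real-valued `η_n`
  set ηr : ℕ → ℝ → ℝ := fun n u ↦ ∫ y in (-1 : ℝ)..1, prolateFun n y * Real.cos (2 * π * y * u)
    with hηr
  have hηc : ∀ n u, prolateEtaFun n u = (ηr n u : ℂ) := fun n u ↦ prolateEtaFun_eq_integral_cos n u
  have hηcont : ∀ n, Continuous (ηr n) := fun n ↦ by
    have e : ηr n = fun u ↦ (prolateEtaFun n u).re := funext fun u ↦ by rw [hηc, Complex.ofReal_re]
    rw [e]
    exact Complex.continuous_re.comp (continuous_prolateEtaFun n)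
  have hηeven : ∀ n u, ηr n (-u) = ηr n u := fun n u ↦ by
    have := prolateEtaFun_neg n u
    rw [hηc, hηc] at this
    exact_mod_cast this
  have hηlam : ∀ n, ∀ x ∈ Icc (-1 : ℝ) 1, ηr n x = prolateEigen n * prolateFun n x := fun n x hx ↦ by
    have key := (isProlateFunction_prolateFun n).integral_mul_cos_eq_mul hx
    rwa [← prolateEigen_eq_intervalIntegral] at key
  set Ir : ℕ → ℝ := fun n ↦ ∫ x in Ioc (0 : ℝ) 1, prolateFun n x * ηr n (ρ * x) with hIr
  -- (i) `λ(n)⟨ξ_n|ϑ(ρ⁻¹)η_n⟩ = 2λ(n)√ρ I_n`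
  have hrep : ∀ n : ℕ, (prolateEigen n : ℂ) * repCoeff (prolateXiFun n) (prolateEtaFun n) ρ
      = ((2 * prolateEigen n * Real.sqrt ρ * Ir n : ℝ) : ℂ) := by
    intro n
    rw [repCoeff_eq hρ0]
    have e1 : (fun x : ℝ ↦ conj (prolateXiFun n x) * (((Real.sqrt ρ : ℝ) : ℂ) * prolateEtaFun n (ρ * x)))
        = fun x : ℝ ↦ ((prolateFun n x * (Real.sqrt ρ * ηr n (ρ * x)) : ℝ) : ℂ) := by
      funext x
      rw [hηc]
      simp only [prolateXiFun, Complex.conj_ofReal]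
      push_cast
      ring
    rw [e1, integral_complex_ofReal, integral_prolateFun_mul_real, ← Complex.ofReal_mul]
    congr 1
    have hc : ContinuousOn (fun x ↦ prolateFun n x * (Real.sqrt ρ * ηr n (ρ * x))) (Icc (-1 : ℝ) 1) :=
      (continuousOn_prolateFun_of_subset n subset_rfl).mul
        ((continuous_const.mul ((hηcont n).comp (continuous_const.mul continuous_id))).continuousOn)
    rw [intervalIntegral_symm_of_even (f := fun x ↦ prolateFun n x * (Real.sqrt ρ * ηr n (ρ * x)))
        (fun x ↦ by rw [prolateFun_neg, mul_neg, hηeven])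
        ((hc.mono (Icc_subset_Icc le_rfl zero_le_one)).intervalIntegrable_of_Icc (by norm_num))
        ((hc.mono (Icc_subset_Icc (by norm_num) le_rfl)).intervalIntegrable_of_Icc zero_le_one),
      intervalIntegral.integral_of_le zero_le_one]
    have e2 : (fun x ↦ prolateFun n x * (Real.sqrt ρ * ηr n (ρ * x)))
        = fun x ↦ Real.sqrt ρ * (prolateFun n x * ηr n (ρ * x)) := by
      funext x; ring
    rw [e2, integral_const_mul]
    ring
  -- (ii) the model: Hilbert basis and the two kernels `b ± a`
  set bH : HilbertBasis ℕ ℂ (Lp ℂ 2 ((volume : Measure ℝ).restrict (Ioc (0 : ℝ) 1))) :=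
    HilbertBasis.mkOfOrthogonalEqBot orthonormal_toLp_sqrt_two_mul_prolateXiFun
      (orthogonal_span_toLp_sqrt_two_mul_prolateXiFun_eq_bot h) with hbdef
  have hb : ∀ n : ℕ, (bH n : Lp ℂ 2 ((volume : Measure ℝ).restrict (Ioc (0 : ℝ) 1)))
      = (memLp_sqrt_two_mul_prolateXiFun_restrict n).toLp _ := fun n ↦ by
    rw [hbdef, HilbertBasis.coe_mkOfOrthogonalEqBot]
  set Kp : ℝ → ℝ → ℂ := fun x y ↦
    ((2 * Real.cos (2 * π * y * x) + 2 * Real.sqrt ρ * Real.cos (2 * π * y * (ρ * x)) : ℝ) : ℂ)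
    with hKp
  set Km : ℝ → ℝ → ℂ := fun x y ↦
    ((2 * Real.cos (2 * π * y * x) - 2 * Real.sqrt ρ * Real.cos (2 * π * y * (ρ * x)) : ℝ) : ℂ)
    with hKm
  have hKpm : StronglyMeasurable (Function.uncurry Kp) := by
    apply Continuous.stronglyMeasurable
    simp only [hKp, Function.uncurry_def]
    fun_prop
  have hKmm : StronglyMeasurable (Function.uncurry Km) := by
    apply Continuous.stronglyMeasurable
    simp only [hKm, Function.uncurry_def]
    fun_prop
  have hcos1 : ∀ t : ℝ, |Real.cos t| ≤ 1 := Real.abs_cos_le_one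
  have hCp : ∀ x y, ‖Kp x y‖ ≤ 2 + 2 * Real.sqrt ρ := fun x y ↦ by
    simp only [hKp, Complex.norm_real, Real.norm_eq_abs]
    refine (abs_add_le _ _).trans ?_
    rw [abs_mul, abs_mul, abs_two, abs_mul, abs_two, abs_of_nonneg hsρ]
    nlinarith [hcos1 (2 * π * y * x), hcos1 (2 * π * y * (ρ * x)), abs_nonneg (Real.cos (2 * π * y * x)),
      abs_nonneg (Real.cos (2 * π * y * (ρ * x)))]
  have hCm : ∀ x y, ‖Km x y‖ ≤ 2 + 2 * Real.sqrt ρ := fun x y ↦ by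
    simp only [hKm, Complex.norm_real, Real.norm_eq_abs]
    refine (abs_sub _ _).trans ?_
    rw [abs_mul, abs_mul, abs_two, abs_mul, abs_two, abs_of_nonneg hsρ]
    nlinarith [hcos1 (2 * π * y * x), hcos1 (2 * π * y * (ρ * x)), abs_nonneg (Real.cos (2 * π * y * x)),
      abs_nonneg (Real.cos (2 * π * y * (ρ * x)))]
  have hsp := hasSum_integral_norm_sq_integral_kernel_mul hKpm hCp bH
  have hsm := hasSum_integral_norm_sq_integral_kernel_mul hKmm hCm bH
  -- the two pieces of the inner integral
  have hpiece : ∀ (n : ℕ) (ω : ℝ), ∫ y in Ioc (0 : ℝ) 1,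
      2 * Real.cos (2 * π * y * ω) * (Real.sqrt 2 * prolateFun n y) = Real.sqrt 2 * ηr n ω :=
    fun n ω ↦ integral_Ioc_cos_kernel_mul_prolateFun_eq n ω
  have hpint : ∀ (n : ℕ) (ω : ℝ), Integrable
      (fun y ↦ 2 * Real.cos (2 * π * y * ω) * (Real.sqrt 2 * prolateFun n y))
      ((volume : Measure ℝ).restrict (Ioc (0 : ℝ) 1)) := fun n ω ↦
    hIo ((continuousOn_const.mul (by fun_prop)).mul (continuousOn_const.mul (hhc n)))
  have hinp : ∀ (n : ℕ) (x : ℝ),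
      ∫ y, Kp x y * bH n y ∂((volume : Measure ℝ).restrict (Ioc (0 : ℝ) 1))
        = ((Real.sqrt 2 * ηr n x + Real.sqrt ρ * (Real.sqrt 2 * ηr n (ρ * x)) : ℝ) : ℂ) := by
    intro n x
    have e1 : ∫ y, Kp x y * bH n y ∂((volume : Measure ℝ).restrict (Ioc (0 : ℝ) 1))
        = ∫ y in Ioc (0 : ℝ) 1, ((2 * Real.cos (2 * π * y * x) * (Real.sqrt 2 * prolateFun n y)
            + Real.sqrt ρ * (2 * Real.cos (2 * π * y * (ρ * x)) * (Real.sqrt 2 * prolateFun n y)) : ℝ) : ℂ) := by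
      refine integral_congr_ae ?_
      rw [hb n]
      filter_upwards [(memLp_sqrt_two_mul_prolateXiFun_restrict n).coeFn_toLp] with y hy
      rw [hy]
      simp only [hKp, prolateXiFun]
      push_cast
      ring
    rw [e1, integral_complex_ofReal, integral_add (hpint n x) ((hpint n (ρ * x)).const_mul _),
      integral_const_mul, hpiece, hpiece]
  have hinm : ∀ (n : ℕ) (x : ℝ),
      ∫ y, Km x y * bH n y ∂((volume : Measure ℝ).restrict (Ioc (0 : ℝ) 1))
        = ((Real.sqrt 2 * ηr n x - Real.sqrt ρ * (Real.sqrt 2 * ηr n (ρ * x)) : ℝ) : ℂ) := by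
    intro n x
    have e1 : ∫ y, Km x y * bH n y ∂((volume : Measure ℝ).restrict (Ioc (0 : ℝ) 1))
        = ∫ y in Ioc (0 : ℝ) 1, ((2 * Real.cos (2 * π * y * x) * (Real.sqrt 2 * prolateFun n y)
            - Real.sqrt ρ * (2 * Real.cos (2 * π * y * (ρ * x)) * (Real.sqrt 2 * prolateFun n y)) : ℝ) : ℂ) := by
      refine integral_congr_ae ?_
      rw [hb n]
      filter_upwards [(memLp_sqrt_two_mul_prolateXiFun_restrict n).coeFn_toLp] with y hy
      rw [hy]
      simp only [hKm, prolateXiFun]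
      push_cast
      ring
    rw [e1, integral_complex_ofReal, integral_sub (hpint n x) ((hpint n (ρ * x)).const_mul _),
      integral_const_mul, hpiece, hpiece]
  -- termwise: `‖T_{b+a}e_n‖² − ‖T_{b−a}e_n‖² = 8λ(n)√ρ I_n`
  have hPQc : ∀ n : ℕ, ContinuousOn (fun x ↦ Real.sqrt 2 * ηr n x) (Icc (0 : ℝ) 1) ∧
      ContinuousOn (fun x ↦ Real.sqrt ρ * (Real.sqrt 2 * ηr n (ρ * x))) (Icc (0 : ℝ) 1) := fun n ↦
    ⟨(continuous_const.mul (hηcont n)).continuousOn,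
      (continuous_const.mul (continuous_const.mul
        ((hηcont n).comp (continuous_const.mul continuous_id)))).continuousOn⟩
  have hterm : ∀ n : ℕ,
      (∫ x, ‖∫ y, Kp x y * bH n y ∂((volume : Measure ℝ).restrict (Ioc (0 : ℝ) 1))‖ ^ 2
          ∂((volume : Measure ℝ).restrict (Ioc (0 : ℝ) 1)))
        - (∫ x, ‖∫ y, Km x y * bH n y ∂((volume : Measure ℝ).restrict (Ioc (0 : ℝ) 1))‖ ^ 2
          ∂((volume : Measure ℝ).restrict (Ioc (0 : ℝ) 1)))
        = 8 * prolateEigen n * Real.sqrt ρ * Ir n := by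
    intro n
    obtain ⟨hPc, hQc⟩ := hPQc n
    have ep : (fun x ↦ ‖∫ y, Kp x y * bH n y ∂((volume : Measure ℝ).restrict (Ioc (0 : ℝ) 1))‖ ^ 2)
        = fun x ↦ (Real.sqrt 2 * ηr n x + Real.sqrt ρ * (Real.sqrt 2 * ηr n (ρ * x))) ^ 2 := by
      funext x
      rw [hinp, Complex.norm_real, Real.norm_eq_abs, sq_abs]
    have em : (fun x ↦ ‖∫ y, Km x y * bH n y ∂((volume : Measure ℝ).restrict (Ioc (0 : ℝ) 1))‖ ^ 2)
        = fun x ↦ (Real.sqrt 2 * ηr n x - Real.sqrt ρ * (Real.sqrt 2 * ηr n (ρ * x))) ^ 2 := by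
      funext x
      rw [hinm, Complex.norm_real, Real.norm_eq_abs, sq_abs]
    have hi1 : Integrable (fun x ↦ (Real.sqrt 2 * ηr n x + Real.sqrt ρ * (Real.sqrt 2 * ηr n (ρ * x))) ^ 2)
        ((volume : Measure ℝ).restrict (Ioc (0 : ℝ) 1)) := hIo ((hPc.add hQc).pow 2)
    have hi2 : Integrable (fun x ↦ (Real.sqrt 2 * ηr n x - Real.sqrt ρ * (Real.sqrt 2 * ηr n (ρ * x))) ^ 2)
        ((volume : Measure ℝ).restrict (Ioc (0 : ℝ) 1)) := hIo ((hPc.sub hQc).pow 2)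
    rw [ep, em, ← integral_sub hi1 hi2]
    have e3 : (fun x ↦ (Real.sqrt 2 * ηr n x + Real.sqrt ρ * (Real.sqrt 2 * ηr n (ρ * x))) ^ 2
        - (Real.sqrt 2 * ηr n x - Real.sqrt ρ * (Real.sqrt 2 * ηr n (ρ * x))) ^ 2)
        = fun x ↦ (8 * Real.sqrt ρ) * (ηr n x * ηr n (ρ * x)) := by
      funext x
      have h2 : Real.sqrt 2 ^ 2 = 2 := Real.sq_sqrt zero_le_two
      linear_combination (4 * Real.sqrt ρ * ηr n x * ηr n (ρ * x)) * h2
    rw [e3, integral_const_mul]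
    have e4 : ∫ x in Ioc (0 : ℝ) 1, ηr n x * ηr n (ρ * x) = prolateEigen n * Ir n := by
      rw [hIr, ← integral_const_mul]
      refine integral_congr_ae ((ae_restrict_iff' measurableSet_Ioc).2 (ae_of_all _ fun x hx ↦ ?_))
      dsimp only
      rw [hηlam n x ⟨by linarith [hx.1], hx.2⟩]
      ring
    rw [e4]
    ring
  -- the value: `∫∫ (|b+a|² − |b−a|²) = ∫∫ 4ab = 16√ρ ∫_Δ… = 4δ(ρ)`
  have hSi : ∀ {K : ℝ → ℝ → ℂ}, StronglyMeasurable (Function.uncurry K) →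
      (∀ x y, ‖K x y‖ ≤ 2 + 2 * Real.sqrt ρ) →
      Integrable (fun x ↦ ∫ y, ‖K x y‖ ^ 2 ∂((volume : Measure ℝ).restrict (Ioc (0 : ℝ) 1)))
        ((volume : Measure ℝ).restrict (Ioc (0 : ℝ) 1)) := by
    intro K hK hC
    have hSm := stronglyMeasurable_integral_norm_kernel_sq
      (μ := (volume : Measure ℝ).restrict (Ioc (0 : ℝ) 1)) hK
    refine (integrable_const ((2 + 2 * Real.sqrt ρ) ^ 2 *
      ((volume : Measure ℝ).restrict (Ioc (0 : ℝ) 1)).real Set.univ)).mono' hSm.aestronglyMeasurable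
      (Eventually.of_forall fun x ↦ ?_)
    rw [Real.norm_of_nonneg (integral_nonneg fun y ↦ by positivity)]
    have h1 : ‖∫ y, ‖K x y‖ ^ 2 ∂((volume : Measure ℝ).restrict (Ioc (0 : ℝ) 1))‖
        ≤ (2 + 2 * Real.sqrt ρ) ^ 2 * ((volume : Measure ℝ).restrict (Ioc (0 : ℝ) 1)).real Set.univ :=
      norm_integral_le_of_norm_le_const (Eventually.of_forall fun y ↦ by
        rw [Real.norm_of_nonneg (by positivity)]
        exact pow_le_pow_left₀ (norm_nonneg _) (hC x y) 2)
    exact (Real.le_norm_self _).trans h1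
  have hval :
      (∫ x, ∫ y, ‖Kp x y‖ ^ 2 ∂((volume : Measure ℝ).restrict (Ioc (0 : ℝ) 1))
          ∂((volume : Measure ℝ).restrict (Ioc (0 : ℝ) 1)))
        - (∫ x, ∫ y, ‖Km x y‖ ^ 2 ∂((volume : Measure ℝ).restrict (Ioc (0 : ℝ) 1))
          ∂((volume : Measure ℝ).restrict (Ioc (0 : ℝ) 1)))
        = 4 * traceRemainder ρ := by
    rw [← integral_sub (hSi hKpm hCp) (hSi hKmm hCm), CC2021_prop_2_2_i_holds ρ hρ,
      deltaSquareIntegral, show 4 * (4 * Real.sqrt ρ *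
        ∫ x in Ioc (0 : ℝ) 1, ∫ y in Ioc (0 : ℝ) 1, Real.cos (2 * π * ρ * x * y) * Real.cos (2 * π * x * y))
        = (16 * Real.sqrt ρ) * ∫ x in Ioc (0 : ℝ) 1, ∫ y in Ioc (0 : ℝ) 1,
          Real.cos (2 * π * ρ * x * y) * Real.cos (2 * π * x * y) by ring, ← integral_const_mul]
    refine integral_congr_ae (ae_of_all _ fun x ↦ ?_)
    dsimp only
    have hyp : Integrable (fun y ↦ ‖Kp x y‖ ^ 2) ((volume : Measure ℝ).restrict (Ioc (0 : ℝ) 1)) :=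
      hIo (by simp only [hKp, Complex.norm_real, Real.norm_eq_abs, sq_abs]; fun_prop)
    have hym : Integrable (fun y ↦ ‖Km x y‖ ^ 2) ((volume : Measure ℝ).restrict (Ioc (0 : ℝ) 1)) :=
      hIo (by simp only [hKm, Complex.norm_real, Real.norm_eq_abs, sq_abs]; fun_prop)
    rw [← integral_sub hyp hym, ← integral_const_mul]
    refine integral_congr_ae (ae_of_all _ fun y ↦ ?_)
    dsimp only
    simp only [hKp, hKm, Complex.norm_real, Real.norm_eq_abs, sq_abs]
    rw [show 2 * π * y * (ρ * x) = 2 * π * ρ * x * y by ring, show 2 * π * y * x = 2 * π * x * y by ring]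
    ring
  -- assemble the real series and pass to `ℂ`
  have hreal : HasSum (fun n : ℕ ↦ 2 * prolateEigen n * Real.sqrt ρ * Ir n) (traceRemainder ρ) := by
    have h1 := (hsp.sub hsm).mul_left (1 / 4 : ℝ)
    have e : (fun i : ℕ ↦ (1 / 4 : ℝ) *
        ((∫ x, ‖∫ y, Kp x y * bH i y ∂((volume : Measure ℝ).restrict (Ioc (0 : ℝ) 1))‖ ^ 2
            ∂((volume : Measure ℝ).restrict (Ioc (0 : ℝ) 1)))
          - (∫ x, ‖∫ y, Km x y * bH i y ∂((volume : Measure ℝ).restrict (Ioc (0 : ℝ) 1))‖ ^ 2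
            ∂((volume : Measure ℝ).restrict (Ioc (0 : ℝ) 1)))))
        = fun n : ℕ ↦ 2 * prolateEigen n * Real.sqrt ρ * Ir n := by
      funext n
      rw [hterm n]
      ring
    rw [e, hval, show (1 / 4 : ℝ) * (4 * traceRemainder ρ) = traceRemainder ρ by ring] at h1
    exact h1
  have hC := Complex.hasSum_ofReal.2 hreal
  have e : (fun n : ℕ ↦ (prolateEigen n : ℂ) * repCoeff (prolateXiFun n) (prolateEtaFun n) ρ)
      = fun n : ℕ ↦ ((2 * prolateEigen n * Real.sqrt ρ * Ir n : ℝ) : ℂ) := funext hrep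
  rw [e]
  exact hC

end TraceModelPolarised

/-! ## Lemma 4.1 and Proposition 4.5 (ii), conditional on completeness -/

section LemmaFourOne

/-- `repCoeff` only sees a.e. classes (transport of null sets along `x ↦ ρx`). [cite: ConnesConsani2021, §4 eq. (40) p. 15 (chunk p0015:L38–L41)] -/
private theorem repCoeff_congr_ae' {u u' v v' : ℝ → ℂ} (hu : u =ᵐ[volume] u') (hv : v =ᵐ[volume] v')
    (ρ : ℝ) : repCoeff u v ρ = repCoeff u' v' ρ := by
  unfold repCoeff scalingCoeff
  refine integral_congr_ae ?_
  have hv' := Literature.Analysis.OperatorTheory.ae_eq_comp_smul (V := ℝ) hv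
    (Real.exp_pos (-(-Real.log ρ))).ne'
  filter_upwards [hu, hv'] with x hx hx'
  simp only [smul_eq_mul] at hx'
  rw [hx, hx']

/-- `repCoeff u (c • v) ρ = c · repCoeff u v ρ`. [cite: ConnesConsani2021, §4 eq. (40) p. 15 (chunk p0015:L38–L41)] -/
private theorem repCoeff_smul_right (u v : ℝ → ℂ) (c : ℂ) (ρ : ℝ) :
    repCoeff u (fun x ↦ c * v x) ρ = c * repCoeff u v ρ := by
  unfold repCoeff scalingCoeff
  rw [← integral_const_mul]
  refine integral_congr_ae (ae_of_all _ fun x ↦ ?_)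
  dsimp only
  ring

/-- `⟨ξ|ϑ(ρ⁻¹)η⟩ = √ρ ⟪ξ, D_ρ η⟫_{L²}` for `L²` classes, `ρ > 0` (as in t3's file). [cite: ConnesConsani2021, §4 eq. (40) p. 15 (chunk p0015:L38–L41)] -/
private theorem repCoeff_eq_inner_lpDilation' (ξ η : Lp ℂ 2 (volume : Measure ℝ)) {ρ : ℝ}
    (hρ : 0 < ρ) : repCoeff ξ η ρ = (Real.sqrt ρ : ℂ) *
      ⟪ξ, lpDilation (V := ℝ) (F := ℂ) (p := (2 : ℝ≥0∞)) ρ hρ.ne' ENNReal.ofNat_ne_top η⟫_ℂ := by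
  rw [repCoeff_eq hρ, MeasureTheory.L2.inner_def, ← integral_const_mul]
  refine integral_congr_ae ?_
  filter_upwards [lpDilation_coeFn (V := ℝ) (F := ℂ) (p := (2 : ℝ≥0∞)) hρ.ne'
    ENNReal.ofNat_ne_top η] with x hx
  rw [RCLike.inner_apply, hx, smul_eq_mul]
  ring

/-- **Lemma 4.1 from completeness**: `CC2021_sec4_xi_complete → CC2021_lem_4_1`, i.e.
`Tr(ϑ(ρ⁻¹)𝒫̂₁𝒫₁) = Σ_n ⟨ξ_n|ϑ(ρ⁻¹)𝒫̂₁𝒫₁ξ_n⟩ = δ(ρ)` for `ρ ≥ 1` (`𝒫̂₁𝒫₁ξ_n = λ(n)η_n`).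
[cite: ConnesConsani2021, Lemma 4.1 §4 p. 15 (arXiv item Lemma 21, chunk p0015:L60–L75)] -/
theorem CC2021_lem_4_1_of_xi_complete (h : CC2021_sec4_xi_complete) : CC2021_lem_4_1 := by
  intro ρ hρ
  have hs := hasSum_prolateEigen_mul_repCoeff_of_xi_complete h hρ
  convert hs using 1
  funext n
  rw [cutoffProj_prolateXi, cutoffProjHat_prolateXi,
    repCoeff_congr_ae' (Filter.EventuallyEq.refl _ _)
      ((Lp.coeFn_smul (prolateEigen n : ℂ) (prolateEta n)).trans
        ((prolateEta_coeFn n).mono fun x hx ↦ by rw [Pi.smul_apply, hx, smul_eq_mul])) ρ,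
    repCoeff_smul_right]

/-- **Proposition 4.5 (ii) from completeness**: `CC2021_sec4_xi_complete → CC2021_prop_4_5_ii`, i.e.
`Σ_n (λ(n)²⟨ξ_n|ϑ(ρ⁻¹)ξ_n⟩ + λ(n)⟨ξ_n|ϑ(ρ⁻¹)ψ_n⟩) = δ(ρ)` for `ρ ≥ 1` (eq. (chirem3):
`λ(n)²⟨ξ_n|ϑξ_n⟩ + λ(n)⟨ξ_n|ϑψ_n⟩ = λ(n)⟨ξ_n|ϑη_n⟩` by `η_n = ψ_n + λ(n)ξ_n`).  This is the binder
`hii` of t4's `CC2021_thm_4_7_weak_of_sec2_sec4` (R45).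
[cite: ConnesConsani2021, Prop. 4.5 (ii) §4 p. 16 eq. (chirem3) (arXiv item Prop. 25, chunk p0016:L52–L55); proof p. 17 (chunk p0017:L1–L12)] -/
theorem CC2021_prop_4_5_ii_of_xi_complete (h : CC2021_sec4_xi_complete) : CC2021_prop_4_5_ii := by
  intro ρ hρ
  have hρ0 : 0 < ρ := by linarith
  have hs := hasSum_prolateEigen_mul_repCoeff_of_xi_complete h hρ
  convert hs using 1
  funext n
  rw [repCoeff_congr_ae' (prolateXi_coeFn n).symm (prolateXi_coeFn n).symm,
    repCoeff_congr_ae' (prolateXi_coeFn n).symm (prolatePsi_coeFn n).symm,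
    repCoeff_congr_ae' (prolateXi_coeFn n).symm (prolateEta_coeFn n).symm,
    repCoeff_eq_inner_lpDilation' _ _ hρ0, repCoeff_eq_inner_lpDilation' _ _ hρ0,
    repCoeff_eq_inner_lpDilation' _ _ hρ0,
    show prolateEta n = prolatePsi n + (prolateEigen n : ℂ) • prolateXi n by
      rw [prolatePsi_eq, sub_add_cancel],
    map_add, map_smul, inner_add_right, inner_smul_right]
  ring

end LemmaFourOne

/-! ## Remark 4.6 (i) from Proposition 4.5 (ii) at `ρ = 1` (seat gm-t14's bridge, no completeness needed)

The next five declarations are seat **gm-t14**'s text (cc/drafts/gm-t14_R58b, 2026-08-26 06:28Z, offered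
under cc-lead R61 (1)), pasted here with cite tags: at `ρ = 1`, `⟨ξ_n|ϑ(1)ξ_n⟩ = ∫φ_n² = 1` and
`⟨ξ_n|ϑ(1)ψ_n⟩ = 0` (disjoint supports, Remark 4.6 (ii): t3's `CC2021_rem_4_6_ii_holds`), so (chirem1)
at `ρ = 1` reads `δ(1) = Σ λ(n)²`. -/

section BridgeAtOne

/-- At `ρ = 1` the matrix coefficient is the `L²` pairing: `⟨u|ϑ(1)v⟩ = ∫ ū v` (gm-t14). [cite: ConnesConsani2021, §4 eq. (40) p. 15 (chunk p0015:L38–L41)] -/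
theorem repCoeff_one (u v : ℝ → ℂ) : repCoeff u v 1 = ∫ x : ℝ, conj (u x) * v x := by
  rw [repCoeff_eq one_pos]
  simp

/-- At `ρ = 1` the coefficient is Hermitian: `⟨u|ϑ(1)v⟩ = conj ⟨v|ϑ(1)u⟩` (gm-t14). [cite: ConnesConsani2021, §4 eq. (40) p. 15 (chunk p0015:L38–L41)] -/
theorem repCoeff_one_comm (u v : ℝ → ℂ) : repCoeff u v 1 = conj (repCoeff v u 1) := by
  rw [repCoeff_one, repCoeff_one, ← integral_conj]
  refine integral_congr_ae (Eventually.of_forall fun x => ?_)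
  simp [mul_comm]

/-- `⟨ξ_n|ϑ(1)ξ_n⟩ = ∫ φ_n² = 1` (gm-t14). [cite: ConnesConsani2021, Remark 4.6 (i) §4 p. 18 (chunk p0018:L20–L30); §4 p. 16 (∫_{−1}^{1}φ_n² = 1)] -/
theorem repCoeff_prolateXiFun_self_one (n : ℕ) : repCoeff (prolateXiFun n) (prolateXiFun n) 1 = 1 := by
  rw [repCoeff_one]
  have h1 : (fun x : ℝ => conj (prolateXiFun n x) * prolateXiFun n x) = fun x => ((prolateFun n x ^ 2 : ℝ) : ℂ) := by
    funext x; simp only [prolateXiFun, conj_ofReal]; push_cast; ring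
  rw [h1, integral_complex_ofReal]
  have h2 : (fun x : ℝ => prolateFun n x ^ 2) = (Icc (-1 : ℝ) 1).indicator fun x => prolateFun n x ^ 2 := by
    funext x
    by_cases hx : x ∈ Icc (-1 : ℝ) 1
    · rw [indicator_of_mem hx]
    · rw [indicator_of_notMem hx, prolateFun_eq_zero_of_notMem hx]; simp
  rw [h2, integral_indicator measurableSet_Icc, integral_Icc_eq_integral_Ioc,
    ← intervalIntegral.integral_of_le (by norm_num : (-1 : ℝ) ≤ 1), (isProlateFunction_prolateFun n).norm_one]
  simp

/-- `⟨ξ_n|ϑ(1)ψ_n⟩ = 0` (Remark 4.6 (ii) at `ρ = 1`, disjoint supports; gm-t14). [cite: ConnesConsani2021, Remark 4.6 (ii) §4 p. 18 (chunk p0018:L31–L40)] -/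
theorem repCoeff_prolateXiFun_prolatePsiFun_one (n : ℕ) :
    repCoeff (prolateXiFun n) (prolatePsiFun n) 1 = 0 := by
  rw [repCoeff_one_comm, (CC2021_rem_4_6_ii_holds n 1 le_rfl).1, map_zero]

/-- **Remark 4.6 (i) from Proposition 4.5 (ii)** (gm-t14): `CC2021_prop_4_5_ii → CC2021_rem_4_6_i`,
i.e. `δ(1) = Σ λ(n)²` is (chirem1) at `ρ = 1` (`⟨ξ_n|ϑ(1)ξ_n⟩ = 1`, `⟨ξ_n|ϑ(1)ψ_n⟩ = 0`); no
completeness hypothesis.  With `CC2021_prop_4_5_ii_of_xi_complete` this re-derives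
`CC2021_rem_4_6_i_of_xi_complete`. [cite: ConnesConsani2021, Remark 4.6 (i) §4 p. 18 (arXiv item Remark 26 (i), chunk p0018:L20–L30)] -/
theorem CC2021_rem_4_6_i_of_prop_4_5_ii (h : CC2021_prop_4_5_ii) : CC2021_rem_4_6_i := by
  have h1 := h 1 le_rfl
  simp only [repCoeff_prolateXiFun_self_one, repCoeff_prolateXiFun_prolatePsiFun_one, mul_one, mul_zero,
    add_zero] at h1
  have h2 : HasSum (fun n : ℕ => ((prolateEigen n ^ 2 : ℝ) : ℂ)) ((traceRemainder 1 : ℝ) : ℂ) := by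
    simpa only [ofReal_pow] using h1
  exact Complex.hasSum_ofReal.mp h2

end BridgeAtOne

/-! ### The four §4 facts as THEOREMS (append #3, 2026-08-26): `CC2021_sec4_xi_complete` is now the tree
theorem `CC2021_sec4_xi_complete_holds` (t10 `ProlateSincOperator` (a) + t3 `ProlateCommutation` (b) +
capstone `ProlateProjectionsCompleteness` (c)), so the conditional reductions above discharge the named
facts `CC2021_prop_4_5_spectral`, `CC2021_prop_4_5_ii`, `CC2021_lem_4_1`, `CC2021_rem_4_6_i` of
`ProlateProjections.lean` outright (`CC2021_rem_4_6_ii_sym` / `_i_pointwise`: t3's `ProlateProjectionsRemark46`).  RH-FREE corpus literature; nothing here bears on the truth of RH. -/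

section Holds

/-- **Eq. (spectral) / (sonine2) is a THEOREM**: `P P̂ P = Σ_n λ(n)²|ζ_n⟩⟨ζ_n| + 𝐒` on `L²(ℝ)_ev`
(discharge of the named fact `CC2021_prop_4_5_spectral`; binder `h₄`/`hsp` of
`CC2021_thm_4_7_weak_of_sec2_sec4`).
[cite: ConnesConsani2021, Prop. 4.5 (iii) proof §4 p. 17 eq. (spectral) (arXiv p0017:L59–L63); Thm. 4.7 proof p. 18 eq. (sonine2) (arXiv p0018:L77–L79)] -/
theorem CC2021_prop_4_5_spectral_holds : CC2021_prop_4_5_spectral :=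
  CC2021_prop_4_5_spectral_of_xi_complete CC2021_sec4_xi_complete_holds

/-- **Proposition 4.5 (ii), eq. (chirem1), is a THEOREM**: for `ρ ≥ 1`,
`δ(ρ) = Σ_n (λ(n)²⟨ξ_n|ϑ(ρ⁻¹)ξ_n⟩ + λ(n)⟨ξ_n|ϑ(ρ⁻¹)ψ_n⟩)` (discharge of the named fact
`CC2021_prop_4_5_ii`; binder `hii` of `CC2021_thm_4_7_weak_of_sec2_sec4`).
[cite: ConnesConsani2021, Prop. 4.5 (ii) §4 p. 16 eq. (chirem1) (arXiv item Proposition 25, p0016:L52–L55); proof p. 17 (arXiv p0017:L1–L12)] -/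
theorem CC2021_prop_4_5_ii_holds : CC2021_prop_4_5_ii :=
  CC2021_prop_4_5_ii_of_xi_complete CC2021_sec4_xi_complete_holds

/-- **Lemma 4.1 is a THEOREM**: `Tr(ϑ(ρ⁻¹)𝒫̂₁𝒫₁) = Σ_n ⟨ξ_n|ϑ(ρ⁻¹)𝒫̂₁𝒫₁ξ_n⟩ = δ(ρ)` for `ρ ≥ 1`
(discharge of the named fact `CC2021_lem_4_1`, typed by t3; handed to this row cc/STATUS 2026-08-26T08:01Z).
[cite: ConnesConsani2021, Lemma 4.1 §4 p. 15 (arXiv item Lemma 21, p0015:L12–L13, eq. (1quantum) p0015:L49–L52); Prop. 4.5 (ii) proof p. 17 (arXiv p0017:L2–L15)] -/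
theorem CC2021_lem_4_1_holds : CC2021_lem_4_1 :=
  CC2021_lem_4_1_of_xi_complete CC2021_sec4_xi_complete_holds

/-- **Remark 4.6 (i) is a THEOREM**: `δ(1) = Σ_n λ(n)²` (`= 2(Si(4π)/(4π) + 1)` by
`CC2021_rem_4_6_i.hasSum_sinIntegral`) (discharge of the named fact `CC2021_rem_4_6_i`; binder `h46i` of
`CC2021_thm_4_7_weak_of_sec2_sec4`).
[cite: ConnesConsani2021, Remark 4.6 (i) §4 p. 18 (arXiv item Remark 26, p0018:L1–L5)] -/
theorem CC2021_rem_4_6_i_holds : CC2021_rem_4_6_i :=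
  CC2021_rem_4_6_i_of_xi_complete CC2021_sec4_xi_complete_holds

/-- Remark 4.6 (i) in closed form, unconditionally: `Σ_n λ(n)² = 2(Si(4π)/(4π) + 1)`.
[cite: ConnesConsani2021, Remark 4.6 (i) §4 p. 18 (arXiv item Remark 26, p0018:L2–L4)] -/
theorem hasSum_prolateEigen_sq_sinIntegral :
    HasSum (fun n : ℕ ↦ prolateEigen n ^ 2) (2 * (sinIntegral (4 * π) / (4 * π) + 1)) :=
  CC2021_rem_4_6_i_holds.hasSum_sinIntegral

end Holds


end Literature.NumberTheory.ConnesConsani2021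

end
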